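import Literature.Probability.RandomPlanarGeometry.HexSAWBrickWallStripCuts
import HarnessLib

/-!
# The four-column insertion on honeycomb strips (the injection behind `μ(S_T) < μ(S_{T+1})` on the brick wall)

Topic `Literature/Probability/RandomPlanarGeometry` (continues `HexSAWBrickWallStripCuts.lean` — the parity-admissible
column cuts `HexBW.admissibleCuts T a υ n` (`c + T` odd) of a self-avoiding walk of the honeycomb strip
`S_T = ℤ × {0,…,T}` of the brick wall, at least `⌊n/(2(T+1))⌋` of them — and `HexSAWBrickWallStripInsertionCore.lean` —
the summation step `HexBW.stripConnectiveConstant_lt_succ_of_insertion`: ANY insertion `Ψ` with per-cut cost `≤ 4T+8`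
mapping (walk of `S_T`, subset of its admissible cuts) injectively to walks of `S_{T+1}` of length `n + Σ cost` proves
`μ(S_T) < μ(S_{T+1})` with the margin `log(1 + μ(S_{T+1})^{-(4T+8)})/(2(T+1))`).  Sources (STATEMENTS only — neither printed proof is the one formalised here): N. Madras, G. Slade, *The
Self-Avoiding Walk* (1993), §8.2, Theorem 8.2.1, eq. (8.2.13), book p. 269 ("`μ(R[k,T]) < μ(R[k,T+1])` for every
`T`", for the tubes/slabs `R[k,T]` of `ℤ^d`; proved there, p. 270, by BRIDGE RENEWAL in the tube, (8.2.15)–(8.2.16),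
qualitatively); for the honeycomb strips of `T` rows N. R. Beaton, M. Bousquet-Mélou, J. de Gier, H. Duminil-Copin,
A. J. Guttmann, *Comm. Math. Phys.* 326 (2014) 727–754, Proposition 7 at `y = 1` [arXiv:1109.0358, PDF p. 11; proof
pp. 11–12] ("For `y > 0`, `μ_T(1,y) < μ_{T+1}(1,y)`. Moreover, as `T → ∞`, `μ_T(1,y) → μ(y)`", proved by PRIME UNFOLDED
ARCHES and the rationality of the strip series, qualitatively).  The proof here is a third one: an INJECTIVE
MULTI-COLUMN INSERTION with explicit cost, the brick-wall edition of the lane's square-lattice file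
`SAWStripInsertionMargin.lean` (two columns per cut there, four here; door «HEX-STRIP-STRICT» of a-idea-1 gen 16,
ROUTES-G16 §2.3 (M3), faces H1–H3; H4 = `…StripCuts`, H5 = `…StripMargin`/`…StripInsertionCore`).  LABEL (lane
pcv-sawmu, lit-1 gen 10 cell): the strict inequality is a CONSOLIDATION of the printed statements BY A NEW PROOF; the
explicit margin it yields (`HexSAWBrickWallStripStrict.lean`) is new and modest (exponentially small in `T`).

## The insertion (all PROVED; namespace `Literature.Probability.RandomPlanarGeometry.SAW.HexBW`, machinery in `HexBW.StripInsertion`)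

Given a walk `ω` of `S_T` (placed: `t ↦ a + υ t`, `(a, υ) ∈ stripPairs T n`) and `R ⊆ admissibleCuts`, the image
`Ψ(ω, R)` (`HexBW.stripInsertion`) is built block by block along `ω`: the column map `σ` fixes the start column and
opens FOUR fresh columns `B₁…B₄ = σ c + 1 … σ c + 4` after every cut `c ∈ R` (`σ(x+1) − σ(x) = 1 + 4·[x ∈ R]`; the shift
is a multiple of `4`, so brick-wall bonds go to brick-wall bonds); every strand of `ω` crossing a cut of `R` is
stretched straight across the block (`+4` steps), except the TOPMOST strand of the cut (row `z`), which makes the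
forced zigzag excursion: up through `{B₁, B₂}` (at each row exactly one of the two columns carries the vertical bond)
to the new row `T + 1`, along it over `B₁, B₂, B₃`, down through `{B₃, B₄}` back to row `z` (`4(T − z) + 6` extra
steps; the parity `c + T` odd makes `B₁` and `B₃` the columns with the bond into row `T + 1`).  Then
(`StripInsertion.nodup_imageList`, `isChain_imageList`) the image is a self-avoiding BRICK-WALL walk of `S_{T+1}` from
the same start, of length `n + Σ_{c ∈ R} cost(c)` (`length_imageList`) with `cost(c) ≤ 4T + 6` (`cost_le`: the lower
strands of one cut lie in distinct rows below the top one), and `(ω, R) ↦ Ψ(ω, R)` is injective (`psi_inj`: the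
columns meeting row `T + 1` are exactly `σ c + 1, σ c + 2, σ c + 3`, `c ∈ R`, which determines `σ` and `R` by
induction from the start column; the image points in the columns `σ(ℤ)` are exactly the anchors `σ(ω t)`, which
returns `ω`).  The shape of the excursion is the pair of index functions `StripInsertion.zcol/zrow` (pure arithmetic
in `J = T − z`; `shape_step` = consecutive points are brick-wall neighbours, `shape_inj` = no repeated point).

## Main statements

* `HexBW.stripInsertion`, `HexBW.stripInsertionCost` (the insertion and its per-cut cost, as functions of the
  shape required by `HexBW.core_of_insertion` of `HexSAWBrickWallStripInsertionCore.lean`);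
* `HexBW.stripInsertionCost_le` (**hcost**, `≤ 4T+8`; sharp form `stripInsertionCost_le_sharp`, `≤ 4T+6`),
  `HexBW.stripInsertion_mem` (**hmem**), `HexBW.stripInsertion_injOn` (**hinj**), packaged as `HexBW.stripInsertion_hyp`.

The door theorems themselves — `μ(S_T) < μ(S_{T+1})` with the margin `log(1 + μ(S_{T+1})^{-(4T+8)})/(2(T+1))`,
strict monotonicity, `μ(S_T) < μ_ℍ` and the floor twin of the locality rate — are the leaf
`HexSAWBrickWallStripStrict.lean` (this file's three hypotheses fed to `HexSAWBrickWallStripInsertionCore.lean`).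

Evidence outside the kernel (lane «pcv-sawmu»): the same definitions modelled in Python reproduce a-idea-1 g16's
`insert4_check.py psi` image-for-image on all pairs `(ω, R)` with `T = 1, n ≤ 12` (26 664 pairs), `T = 2, n ≤ 8`,
`T = 3, n ≤ 8` (injective, images brick-wall SAWs of `S_{T+1}`, cost per cut `≤ 4T+6`).
-/

noncomputable section

open Finset Literature.Probability.LatticeModels Literature.Probability.Percolation SimpleGraph

namespace Literature.Probability.RandomPlanarGeometry.SAW.HexBW

namespace StripInsertion

/-! ### Planar sites by coordinates -/

/-- The site `(x, y)` of `ℤ²` (column `x`, row `y`). [cite: EntingJensen2009, §7.4.2, Fig. 7.10 (brickwork form of the honeycomb lattice)] -/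
def mk (x y : ℤ) : Site 2 := ![x, y]

/-- The column of `mk x y`. [cite: EntingJensen2009, §7.4.2, Fig. 7.10 (brickwork form of the honeycomb lattice)] -/
@[simp] theorem mk_zero (x y : ℤ) : mk x y 0 = x := rfl
/-- The row of `mk x y`. [cite: EntingJensen2009, §7.4.2, Fig. 7.10 (brickwork form of the honeycomb lattice)] -/
@[simp] theorem mk_one (x y : ℤ) : mk x y 1 = y := rfl

/-- Two sites are equal iff their coordinates are. [cite: EntingJensen2009, §7.4.2, Fig. 7.10 (brickwork form of the honeycomb lattice)] -/
theorem mk_inj {x y x' y' : ℤ} : mk x y = mk x' y' ↔ x = x' ∧ y = y' := by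
  constructor
  · intro h
    exact ⟨by simpa using congrFun h 0, by simpa using congrFun h 1⟩
  · rintro ⟨rfl, rfl⟩; rfl

/-- Every planar site is `mk` of its coordinates. [cite: EntingJensen2009, §7.4.2, Fig. 7.10 (brickwork form of the honeycomb lattice)] -/
theorem eq_mk (p : Site 2) : p = mk (p 0) (p 1) := by
  funext i; fin_cases i <;> rfl

/-- Brick-wall adjacency in coordinates: a horizontal step, or a vertical step along a bond `{(a,b),(a,b+1)}`
with `a + b` even. [cite: EntingJensen2009, §7.4.2, Fig. 7.10 (brickwork form of the honeycomb lattice)] -/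
theorem adj_mk_iff {x y x' y' : ℤ} :
    brickWallGraph.Adj (mk x y) (mk x' y') ↔
      ((x' = x + 1 ∨ x = x' + 1) ∧ y' = y) ∨
        (x' = x ∧ ((y' = y + 1 ∧ (x + y) % 2 = 0) ∨ (y = y' + 1 ∧ (x' + y') % 2 = 0))) := by
  rw [brickWallGraph_adj_coord]; simp only [mk_zero, mk_one]

/-! ### The column map `σ` (base column `x₀`, four columns inserted after each cut of `R`) -/

/-- The column map of the insertion at the cuts `R` with base column `x₀`: `σ(x₀) = x₀` and
`σ(x+1) − σ(x) = 5` if `x ∈ R` (four columns inserted after column `x`), `= 1` otherwise. [cite: MadrasSlade1993, Theorem 8.2.1 (8.2.13), p. 269 (statement; the insertion here is the lane's proof, not the printed one)] -/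
def colMap (x₀ : ℤ) (R : Finset ℤ) (x : ℤ) : ℤ :=
  x + 4 * ∑ c ∈ R, ((if c < x then (1 : ℤ) else 0) - (if c < x₀ then (1 : ℤ) else 0))

/-- `σ(x₀) = x₀`. [cite: MadrasSlade1993, Theorem 8.2.1 (8.2.13), p. 269 (statement; the insertion here is the lane's proof, not the printed one)] -/
theorem colMap_base (x₀ : ℤ) (R : Finset ℤ) : colMap x₀ R x₀ = x₀ := by
  simp [colMap]

/-- `σ(x) = x + 4k` for an integer `k` (so `σ` preserves the parity of `x + y`). [cite: MadrasSlade1993, Theorem 8.2.1 (8.2.13), p. 269 (statement; the insertion here is the lane's proof, not the printed one)] -/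
theorem colMap_eq_add (x₀ : ℤ) (R : Finset ℤ) (x : ℤ) : ∃ k : ℤ, colMap x₀ R x = x + 4 * k := ⟨_, rfl⟩

/-- The increment of `σ`: `σ(x+1) = σ(x) + 1 + 4·[x ∈ R]`. [cite: MadrasSlade1993, Theorem 8.2.1 (8.2.13), p. 269 (statement; the insertion here is the lane's proof, not the printed one)] -/
theorem colMap_succ (x₀ : ℤ) (R : Finset ℤ) (x : ℤ) :
    colMap x₀ R (x + 1) = colMap x₀ R x + 1 + 4 * (if x ∈ R then 1 else 0) := by
  have key : ∀ c : ℤ, ((if c < x + 1 then (1 : ℤ) else 0) - (if c < x₀ then (1 : ℤ) else 0)) =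
      ((if c < x then (1 : ℤ) else 0) - (if c < x₀ then (1 : ℤ) else 0)) + (if c = x then 1 else 0) := by
    intro c
    split_ifs <;> first | contradiction | omega
  simp only [colMap]
  rw [Finset.sum_congr rfl fun c _ => key c, Finset.sum_add_distrib, Finset.sum_ite_eq']
  ring

/-- `σ(x+1) = σ(x) + 5` for `x ∈ R`. [cite: MadrasSlade1993, Theorem 8.2.1 (8.2.13), p. 269 (statement; the insertion here is the lane's proof, not the printed one)] -/
theorem colMap_succ_of_mem {x₀ : ℤ} {R : Finset ℤ} {x : ℤ} (hx : x ∈ R) :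
    colMap x₀ R (x + 1) = colMap x₀ R x + 5 := by
  rw [colMap_succ, if_pos hx]; ring

/-- `σ(x+1) = σ(x) + 1` for `x ∉ R`. [cite: MadrasSlade1993, Theorem 8.2.1 (8.2.13), p. 269 (statement; the insertion here is the lane's proof, not the printed one)] -/
theorem colMap_succ_of_not_mem {x₀ : ℤ} {R : Finset ℤ} {x : ℤ} (hx : x ∉ R) :
    colMap x₀ R (x + 1) = colMap x₀ R x + 1 := by
  rw [colMap_succ, if_neg hx]; ring

/-- `σ` increases at every step. [cite: MadrasSlade1993, Theorem 8.2.1 (8.2.13), p. 269 (statement; the insertion here is the lane's proof, not the printed one)] -/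
theorem colMap_lt_succ (x₀ : ℤ) (R : Finset ℤ) (x : ℤ) : colMap x₀ R x < colMap x₀ R (x + 1) := by
  rw [colMap_succ]; split_ifs <;> first | contradiction | omega

/-- `σ` is strictly increasing. [cite: MadrasSlade1993, Theorem 8.2.1 (8.2.13), p. 269 (statement; the insertion here is the lane's proof, not the printed one)] -/
theorem colMap_strictMono (x₀ : ℤ) (R : Finset ℤ) : StrictMono (colMap x₀ R) :=
  strictMono_int_of_lt_succ (colMap_lt_succ x₀ R)

/-- `σ` is injective. [cite: MadrasSlade1993, Theorem 8.2.1 (8.2.13), p. 269 (statement; the insertion here is the lane's proof, not the printed one)] -/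
theorem colMap_injective (x₀ : ℤ) (R : Finset ℤ) : Function.Injective (colMap x₀ R) :=
  (colMap_strictMono x₀ R).injective

/-- `σ` reflects and preserves `≤`. [cite: MadrasSlade1993, Theorem 8.2.1 (8.2.13), p. 269 (statement; the insertion here is the lane's proof, not the printed one)] -/
theorem colMap_le_iff (x₀ : ℤ) (R : Finset ℤ) {x y : ℤ} : colMap x₀ R x ≤ colMap x₀ R y ↔ x ≤ y :=
  (colMap_strictMono x₀ R).le_iff_le

/-- The four inserted columns `σ c + 1, …, σ c + 4` after a cut `c ∈ R` are not in the range of `σ`.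
[cite: MadrasSlade1993, Theorem 8.2.1 (8.2.13), p. 269 (statement; the insertion here is the lane's proof, not the printed one)] -/
theorem colMap_ne_ins {x₀ : ℤ} {R : Finset ℤ} {c : ℤ} (hc : c ∈ R) (x : ℤ) {j : ℤ} (hj1 : 1 ≤ j)
    (hj2 : j ≤ 4) : colMap x₀ R x ≠ colMap x₀ R c + j := by
  intro h
  rcases le_or_gt x c with hxc | hxc
  · have := (colMap_le_iff x₀ R).2 hxc
    omega
  · have h1 : c + 1 ≤ x := hxc
    have := (colMap_le_iff x₀ R).2 h1
    rw [colMap_succ_of_mem hc] at this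
    omega

/-- Inserted columns of distinct cuts are distinct. [cite: MadrasSlade1993, Theorem 8.2.1 (8.2.13), p. 269 (statement; the insertion here is the lane's proof, not the printed one)] -/
theorem ins_ne_ins {x₀ : ℤ} {R : Finset ℤ} {c c' : ℤ} (hc : c ∈ R) (hc' : c' ∈ R) (hcc : c ≠ c')
    {j j' : ℤ} (hj1 : 1 ≤ j) (hj2 : j ≤ 4) (hj1' : 1 ≤ j') (hj2' : j' ≤ 4) :
    colMap x₀ R c + j ≠ colMap x₀ R c' + j' := by
  intro h
  rcases lt_or_gt_of_ne hcc with hlt | hlt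
  · have h1 : c + 1 ≤ c' := hlt
    have := (colMap_le_iff x₀ R).2 h1
    rw [colMap_succ_of_mem hc] at this
    omega
  · have h1 : c' + 1 ≤ c := hlt
    have := (colMap_le_iff x₀ R).2 h1
    rw [colMap_succ_of_mem hc'] at this
    omega

/-- The induced map on sites (columns moved, rows kept). [cite: MadrasSlade1993, Theorem 8.2.1 (8.2.13), p. 269 (statement; the insertion here is the lane's proof, not the printed one)] -/
def smap (x₀ : ℤ) (R : Finset ℤ) (p : Site 2) : Site 2 := mk (colMap x₀ R (p 0)) (p 1)

/-- The column of `smap`. [cite: MadrasSlade1993, Theorem 8.2.1 (8.2.13), p. 269 (statement; the insertion here is the lane's proof, not the printed one)] -/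
@[simp] theorem smap_zero (x₀ : ℤ) (R : Finset ℤ) (p : Site 2) : smap x₀ R p 0 = colMap x₀ R (p 0) := rfl
/-- The row of `smap`. [cite: MadrasSlade1993, Theorem 8.2.1 (8.2.13), p. 269 (statement; the insertion here is the lane's proof, not the printed one)] -/
@[simp] theorem smap_one (x₀ : ℤ) (R : Finset ℤ) (p : Site 2) : smap x₀ R p 1 = p 1 := rfl

/-- `smap` is injective. [cite: MadrasSlade1993, Theorem 8.2.1 (8.2.13), p. 269 (statement; the insertion here is the lane's proof, not the printed one)] -/
theorem smap_injective (x₀ : ℤ) (R : Finset ℤ) : Function.Injective (smap x₀ R) := by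
  intro p q h
  have h0 : colMap x₀ R (p 0) = colMap x₀ R (q 0) := by simpa using congrFun h 0
  have h1 : p 1 = q 1 := by simpa using congrFun h 1
  rw [eq_mk p, eq_mk q, colMap_injective x₀ R h0, h1]

/-- `smap` fixes the sites of the base column. [cite: MadrasSlade1993, Theorem 8.2.1 (8.2.13), p. 269 (statement; the insertion here is the lane's proof, not the printed one)] -/
theorem smap_eq_self_of_col {x₀ : ℤ} (R : Finset ℤ) {p : Site 2} (hp : p 0 = x₀) : smap x₀ R p = p := by
  rw [eq_mk p, hp]; unfold smap; simp [colMap_base]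

/-- `smap` carries brick-wall bonds between sites of consecutive NON-cut columns, or of one column, to
brick-wall bonds (the shift is a multiple of `4`, so parities are kept). [cite: MadrasSlade1993, Theorem 8.2.1 (8.2.13), p. 269 (statement; the insertion here is the lane's proof, not the printed one)] -/
theorem adj_smap_of_adj {x₀ : ℤ} {R : Finset ℤ} {p q : Site 2} (h : brickWallGraph.Adj p q)
    (hpq : p 0 ≠ q 0 → min (p 0) (q 0) ∉ R) : brickWallGraph.Adj (smap x₀ R p) (smap x₀ R q) := by
  obtain ⟨k, hk⟩ := colMap_eq_add x₀ R (p 0)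
  obtain ⟨k', hk'⟩ := colMap_eq_add x₀ R (q 0)
  unfold smap
  rw [adj_mk_iff]
  rw [brickWallGraph_adj_coord] at h
  rcases h with ⟨h0 | h0, h1⟩ | ⟨h0, hv⟩
  · have hn : p 0 ∉ R := by have := hpq (by omega); rwa [min_eq_left (by omega)] at this
    have := colMap_succ_of_not_mem (x₀ := x₀) hn
    rw [← h0] at this
    left; exact ⟨Or.inl this, h1⟩
  · have hn : q 0 ∉ R := by have := hpq (by omega); rwa [min_eq_right (by omega)] at this
    have := colMap_succ_of_not_mem (x₀ := x₀) hn
    rw [← h0] at this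
    left; exact ⟨Or.inr this, h1⟩
  · right
    rw [h0] at hk'
    rw [h0]
    refine ⟨rfl, ?_⟩
    rcases hv with ⟨h1, hp⟩ | ⟨h1, hp⟩
    · left; exact ⟨h1, by omega⟩
    · right; exact ⟨h1, by omega⟩

/-! ### The shape of the excursion of the top strand (indices `i < 4J + 6`, `J = T − row`) -/

/-- Column offset (`1…4`, from `σ c`) of the `i`-th point of the excursion with `J` rows to climb:
`(B₁,z)`, [`(B₂,z)` if `J` odd], the forced up-zigzag in `{B₁,B₂}` through the rows `z+1…z+J`, the row
`z+J+1 = T+1` at `B₁,B₂,B₃`, the forced down-zigzag in `{B₃,B₄}`, [`(B₃,z)` if `J` even], `(B₄,z)`. [cite: MadrasSlade1993, Theorem 8.2.1 (8.2.13), p. 269 (statement; the insertion here is the lane's proof, not the printed one)] -/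
def zcol (J i : ℕ) : ℕ :=
  if i = 0 then 1
  else if i < 1 + J % 2 then 2
  else if i < 1 + J % 2 + 2 * J then 1 + ((i - (1 + J % 2)) / 2 + (i - (1 + J % 2)) % 2 + J) % 2
  else if i < 1 + J % 2 + 2 * J + 3 then i + 1 - (1 + J % 2 + 2 * J)
  else if i < 1 + J % 2 + 4 * J + 3 then
    3 + ((i - (1 + J % 2 + 2 * J + 3)) / 2 + (i - (1 + J % 2 + 2 * J + 3)) % 2) % 2
  else if i = 1 + J % 2 + 4 * J + 3 then 3 + J % 2
  else 4

/-- Row offset (`0…J+1`, from the row `z` of the strand) of the `i`-th point of the excursion. [cite: MadrasSlade1993, Theorem 8.2.1 (8.2.13), p. 269 (statement; the insertion here is the lane's proof, not the printed one)] -/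
def zrow (J i : ℕ) : ℕ :=
  if i < 1 + J % 2 then 0
  else if i < 1 + J % 2 + 2 * J then (i - (1 + J % 2)) / 2 + 1
  else if i < 1 + J % 2 + 2 * J + 3 then J + 1
  else if i < 1 + J % 2 + 4 * J + 3 then J - (i - (1 + J % 2 + 2 * J + 3)) / 2
  else 0

/-- Region 0: the first point `(B₁, z)`. [cite: MadrasSlade1993, Theorem 8.2.1 (8.2.13), p. 269 (statement; the insertion here is the lane's proof, not the printed one)] -/
theorem shape_zero (J : ℕ) : zcol J 0 = 1 ∧ zrow J 0 = 0 := by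
  unfold zcol zrow; constructor <;> split_ifs <;> first | contradiction | omega

/-- Region 0 (hypothesis form). [cite: MadrasSlade1993, Theorem 8.2.1 (8.2.13), p. 269 (statement; the insertion here is the lane's proof, not the printed one)] -/
theorem shape_zero' {J i : ℕ} (h : i = 0) : zcol J i = 1 ∧ zrow J i = 0 := by
  subst h; exact shape_zero J

/-- Region 1 (`J` odd, `i = 1`): the point `(B₂, z)`. [cite: MadrasSlade1993, Theorem 8.2.1 (8.2.13), p. 269 (statement; the insertion here is the lane's proof, not the printed one)] -/
theorem shape_one {J i : ℕ} (h0 : i ≠ 0) (h1 : i < 1 + J % 2) : zcol J i = 2 ∧ zrow J i = 0 := by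
  unfold zcol zrow; constructor <;> split_ifs <;> first | contradiction | omega

/-- Region 2: the up-zigzag, `i = 1 + J%2 + k`, `k < 2J`: column `B₁ + (k/2 + k%2 + J) % 2`, row `z + k/2 + 1`.
[cite: MadrasSlade1993, Theorem 8.2.1 (8.2.13), p. 269 (statement; the insertion here is the lane's proof, not the printed one)] -/
theorem shape_up {J i : ℕ} (h1 : 1 + J % 2 ≤ i) (h2 : i < 1 + J % 2 + 2 * J) :
    zcol J i = 1 + ((i - (1 + J % 2)) / 2 + (i - (1 + J % 2)) % 2 + J) % 2 ∧
      zrow J i = (i - (1 + J % 2)) / 2 + 1 := by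
  unfold zcol zrow; constructor <;> split_ifs <;> first | contradiction | omega

/-- Region 3: the top row `T + 1 = z + J + 1`, columns `B₁, B₂, B₃`. [cite: MadrasSlade1993, Theorem 8.2.1 (8.2.13), p. 269 (statement; the insertion here is the lane's proof, not the printed one)] -/
theorem shape_top {J i : ℕ} (h1 : 1 + J % 2 + 2 * J ≤ i) (h2 : i < 1 + J % 2 + 2 * J + 3) :
    zcol J i = i + 1 - (1 + J % 2 + 2 * J) ∧ zrow J i = J + 1 := by
  unfold zcol zrow; constructor <;> split_ifs <;> first | contradiction | omega

/-- Region 4: the down-zigzag, `i = 1 + J%2 + 2J + 3 + k`, `k < 2J`: column `B₃ + (k/2 + k%2) % 2`,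
row `z + J − k/2`. [cite: MadrasSlade1993, Theorem 8.2.1 (8.2.13), p. 269 (statement; the insertion here is the lane's proof, not the printed one)] -/
theorem shape_down {J i : ℕ} (h1 : 1 + J % 2 + 2 * J + 3 ≤ i) (h2 : i < 1 + J % 2 + 4 * J + 3) :
    zcol J i = 3 + ((i - (1 + J % 2 + 2 * J + 3)) / 2 + (i - (1 + J % 2 + 2 * J + 3)) % 2) % 2 ∧
      zrow J i = J - (i - (1 + J % 2 + 2 * J + 3)) / 2 := by
  unfold zcol zrow; constructor <;> split_ifs <;> first | contradiction | omega

/-- Region 5: the point `(B₃ + J%2, z)`. [cite: MadrasSlade1993, Theorem 8.2.1 (8.2.13), p. 269 (statement; the insertion here is the lane's proof, not the printed one)] -/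
theorem shape_bot {J i : ℕ} (h : i = 1 + J % 2 + 4 * J + 3) : zcol J i = 3 + J % 2 ∧ zrow J i = 0 := by
  unfold zcol zrow; constructor <;> split_ifs <;> first | contradiction | omega

/-- Region 6 (`J` even): the last point `(B₄, z)`. [cite: MadrasSlade1993, Theorem 8.2.1 (8.2.13), p. 269 (statement; the insertion here is the lane's proof, not the printed one)] -/
theorem shape_last' {J i : ℕ} (h : 1 + J % 2 + 4 * J + 3 < i) : zcol J i = 4 ∧ zrow J i = 0 := by
  unfold zcol zrow; constructor <;> split_ifs <;> first | contradiction | omega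

/-- The last point of the excursion is `(B₄, z)`. [cite: MadrasSlade1993, Theorem 8.2.1 (8.2.13), p. 269 (statement; the insertion here is the lane's proof, not the printed one)] -/
theorem shape_last (J : ℕ) : zcol J (4 * J + 5) = 4 ∧ zrow J (4 * J + 5) = 0 := by
  unfold zcol zrow; constructor <;> split_ifs <;> first | contradiction | omega

/-- Ranges: columns `1…4`, rows `0…J+1`. [cite: MadrasSlade1993, Theorem 8.2.1 (8.2.13), p. 269 (statement; the insertion here is the lane's proof, not the printed one)] -/
theorem shape_range (J i : ℕ) : 1 ≤ zcol J i ∧ zcol J i ≤ 4 ∧ zrow J i ≤ J + 1 := by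
  unfold zcol zrow; refine ⟨?_, ?_, ?_⟩ <;> split_ifs <;> first | contradiction | omega

/-- Only `B₁, B₂, B₃` meet the top row. [cite: MadrasSlade1993, Theorem 8.2.1 (8.2.13), p. 269 (statement; the insertion here is the lane's proof, not the printed one)] -/
theorem zcol_le_three_of_top {J i : ℕ} (h : zrow J i = J + 1) : zcol J i ≤ 3 := by
  revert h; unfold zcol zrow; split_ifs <;> intro h <;> first | contradiction | omega

/-- The three top points are attained. [cite: MadrasSlade1993, Theorem 8.2.1 (8.2.13), p. 269 (statement; the insertion here is the lane's proof, not the printed one)] -/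
theorem exists_top (J : ℕ) {j : ℕ} (hj1 : 1 ≤ j) (hj3 : j ≤ 3) :
    ∃ i < 4 * J + 6, zcol J i = j ∧ zrow J i = J + 1 := by
  refine ⟨1 + J % 2 + 2 * J + (j - 1), by omega, ?_⟩
  have := shape_top (J := J) (i := 1 + J % 2 + 2 * J + (j - 1)) (by omega) (by omega)
  omega


/-- The seven regions of the excursion index, with the explicit columns and rows. [cite: MadrasSlade1993, Theorem 8.2.1 (8.2.13), p. 269 (statement; the insertion here is the lane's proof, not the printed one)] -/
theorem shape_cases {J i : ℕ} (hi : i < 4 * J + 6) :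
    (i = 0 ∧ zcol J i = 1 ∧ zrow J i = 0) ∨
    (i = 1 ∧ J % 2 = 1 ∧ zcol J i = 2 ∧ zrow J i = 0) ∨
    (1 + J % 2 ≤ i ∧ i < 1 + J % 2 + 2 * J ∧
      zcol J i = 1 + ((i - (1 + J % 2)) / 2 + (i - (1 + J % 2)) % 2 + J) % 2 ∧
      zrow J i = (i - (1 + J % 2)) / 2 + 1) ∨
    (1 + J % 2 + 2 * J ≤ i ∧ i < 1 + J % 2 + 2 * J + 3 ∧
      zcol J i = i + 1 - (1 + J % 2 + 2 * J) ∧ zrow J i = J + 1) ∨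
    (1 + J % 2 + 2 * J + 3 ≤ i ∧ i < 1 + J % 2 + 4 * J + 3 ∧
      zcol J i = 3 + ((i - (1 + J % 2 + 2 * J + 3)) / 2 + (i - (1 + J % 2 + 2 * J + 3)) % 2) % 2 ∧
      zrow J i = J - (i - (1 + J % 2 + 2 * J + 3)) / 2) ∨
    (i = 1 + J % 2 + 4 * J + 3 ∧ zcol J i = 3 + J % 2 ∧ zrow J i = 0) ∨
    (i = 4 * J + 5 ∧ J % 2 = 0 ∧ zcol J i = 4 ∧ zrow J i = 0) := by
  rcases Nat.lt_or_ge i (1 + J % 2) with h1 | h1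
  · rcases eq_or_ne i 0 with rfl | h0
    · exact Or.inl ⟨rfl, shape_zero J⟩
    · have := shape_one h0 h1
      exact Or.inr (Or.inl ⟨by omega, by omega, this⟩)
  rcases Nat.lt_or_ge i (1 + J % 2 + 2 * J) with h2 | h2
  · exact Or.inr (Or.inr (Or.inl ⟨h1, h2, shape_up h1 h2⟩))
  rcases Nat.lt_or_ge i (1 + J % 2 + 2 * J + 3) with h3 | h3
  · exact Or.inr (Or.inr (Or.inr (Or.inl ⟨h2, h3, shape_top h2 h3⟩)))
  rcases Nat.lt_or_ge i (1 + J % 2 + 4 * J + 3) with h4 | h4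
  · exact Or.inr (Or.inr (Or.inr (Or.inr (Or.inl ⟨h3, h4, shape_down h3 h4⟩))))
  rcases eq_or_ne i (1 + J % 2 + 4 * J + 3) with h5 | h5
  · exact Or.inr (Or.inr (Or.inr (Or.inr (Or.inr (Or.inl ⟨h5, shape_bot h5⟩)))))
  · have := shape_last' (J := J) (i := i) (by omega)
    exact Or.inr (Or.inr (Or.inr (Or.inr (Or.inr (Or.inr ⟨by omega, by omega, this⟩)))))

/-- **Consecutive points of the excursion are brick-wall neighbours**: a horizontal unit step, or a vertical
unit step at a column `B_c` and lower row `z + r` with `c + r + J + 1` even (with `B₁ + T` even this is the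
bond condition). [cite: MadrasSlade1993, Theorem 8.2.1 (8.2.13), p. 269 (statement; the insertion here is the lane's proof, not the printed one)] -/
theorem shape_step {J i : ℕ} (hi : i + 1 < 4 * J + 6) :
    (zrow J (i + 1) = zrow J i ∧ (zcol J (i + 1) = zcol J i + 1 ∨ zcol J i = zcol J (i + 1) + 1)) ∨
    (zcol J (i + 1) = zcol J i ∧
      ((zrow J (i + 1) = zrow J i + 1 ∧ (zcol J i + zrow J i + J + 1) % 2 = 0) ∨
        (zrow J i = zrow J (i + 1) + 1 ∧ (zcol J i + zrow J (i + 1) + J + 1) % 2 = 0))) := by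
  rcases Nat.lt_or_ge i (1 + J % 2) with h1 | h1
  · -- regions 0 / 1
    rcases eq_or_ne i 0 with h0 | h0
    · obtain ⟨hc, hr⟩ := shape_zero' (J := J) h0
      rcases Nat.lt_or_ge (i + 1) (1 + J % 2) with h2 | h2
      · obtain ⟨hc', hr'⟩ := shape_one (J := J) (i := i + 1) (by omega) h2
        left; exact ⟨by omega, Or.inl (by omega)⟩
      · rcases Nat.lt_or_ge (i + 1) (1 + J % 2 + 2 * J) with h3 | h3
        · obtain ⟨hc', hr'⟩ := shape_up (J := J) (i := i + 1) h2 h3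
          have e : (i + 1 - (1 + J % 2)) = 0 := by omega
          rw [e] at hc' hr'
          norm_num at hc' hr'
          right; exact ⟨by omega, Or.inl ⟨by omega, by omega⟩⟩
        · obtain ⟨hc', hr'⟩ := shape_top (J := J) (i := i + 1) h3 (by omega)
          right; exact ⟨by omega, Or.inl ⟨by omega, by omega⟩⟩
    · obtain ⟨hc, hr⟩ := shape_one h0 h1
      obtain ⟨hc', hr'⟩ := shape_up (J := J) (i := i + 1) (by omega) (by omega)
      have e : (i + 1 - (1 + J % 2)) = 0 := by omega
      rw [e] at hc' hr'
      norm_num at hc' hr'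
      right; exact ⟨by omega, Or.inl ⟨by omega, by omega⟩⟩
  rcases Nat.lt_or_ge i (1 + J % 2 + 2 * J) with h2 | h2
  · -- region 2 (up-zigzag), with `i = 1 + J%2 + k`
    obtain ⟨k, rfl⟩ : ∃ k, i = 1 + J % 2 + k := ⟨i - (1 + J % 2), by omega⟩
    obtain ⟨hc, hr⟩ := shape_up h1 h2
    rw [Nat.add_sub_cancel_left] at hc hr
    rcases Nat.lt_or_ge (1 + J % 2 + k + 1) (1 + J % 2 + 2 * J) with h3 | h3
    · obtain ⟨hc', hr'⟩ := shape_up (J := J) (i := 1 + J % 2 + k + 1) (by omega) h3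
      rw [show 1 + J % 2 + k + 1 - (1 + J % 2) = k + 1 by omega] at hc' hr'
      rcases Nat.mod_two_eq_zero_or_one k with hk | hk
      · have e1 : (k + 1) / 2 = k / 2 := by omega
        have e2 : (k + 1) % 2 = 1 := by omega
        rw [e1, e2] at hc'; rw [e1] at hr'; rw [hk] at hc
        left; exact ⟨by omega, by omega⟩
      · have e1 : (k + 1) / 2 = k / 2 + 1 := by omega
        have e2 : (k + 1) % 2 = 0 := by omega
        rw [e1, e2] at hc'; rw [e1] at hr'; rw [hk] at hc
        right; exact ⟨by omega, Or.inl ⟨by omega, by omega⟩⟩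
    · obtain ⟨hc', hr'⟩ := shape_top (J := J) (i := 1 + J % 2 + k + 1) h3 (by omega)
      have hk : k = 2 * J - 1 := by omega
      have e1 : k / 2 = J - 1 := by omega
      have e2 : k % 2 = 1 := by omega
      rw [e1, e2] at hc; rw [e1] at hr
      right; exact ⟨by omega, Or.inl ⟨by omega, by omega⟩⟩
  rcases Nat.lt_or_ge i (1 + J % 2 + 2 * J + 3) with h3 | h3
  · -- region 3 (top row)
    obtain ⟨hc, hr⟩ := shape_top h2 h3
    rcases Nat.lt_or_ge (i + 1) (1 + J % 2 + 2 * J + 3) with h4 | h4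
    · obtain ⟨hc', hr'⟩ := shape_top (J := J) (i := i + 1) (by omega) h4
      left; exact ⟨by omega, Or.inl (by omega)⟩
    · rcases Nat.lt_or_ge (i + 1) (1 + J % 2 + 4 * J + 3) with h5 | h5
      · obtain ⟨hc', hr'⟩ := shape_down (J := J) (i := i + 1) h4 h5
        rw [show i + 1 - (1 + J % 2 + 2 * J + 3) = 0 by omega] at hc' hr'
        norm_num at hc' hr'
        right; exact ⟨by omega, Or.inr ⟨by omega, by omega⟩⟩
      · obtain ⟨hc', hr'⟩ := shape_bot (J := J) (i := i + 1) (by omega)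
        right; exact ⟨by omega, Or.inr ⟨by omega, by omega⟩⟩
  rcases Nat.lt_or_ge i (1 + J % 2 + 4 * J + 3) with h4 | h4
  · -- region 4 (down-zigzag), with `i = 1 + J%2 + 2J + 3 + k`
    obtain ⟨k, rfl⟩ : ∃ k, i = 1 + J % 2 + 2 * J + 3 + k := ⟨i - (1 + J % 2 + 2 * J + 3), by omega⟩
    obtain ⟨hc, hr⟩ := shape_down h3 h4
    rw [Nat.add_sub_cancel_left] at hc hr
    rcases Nat.lt_or_ge (1 + J % 2 + 2 * J + 3 + k + 1) (1 + J % 2 + 4 * J + 3) with h5 | h5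
    · obtain ⟨hc', hr'⟩ := shape_down (J := J) (i := 1 + J % 2 + 2 * J + 3 + k + 1) (by omega) h5
      rw [show 1 + J % 2 + 2 * J + 3 + k + 1 - (1 + J % 2 + 2 * J + 3) = k + 1 by omega] at hc' hr'
      rcases Nat.mod_two_eq_zero_or_one k with hk | hk
      · have e1 : (k + 1) / 2 = k / 2 := by omega
        have e2 : (k + 1) % 2 = 1 := by omega
        rw [e1, e2] at hc'; rw [e1] at hr'; rw [hk] at hc
        left; exact ⟨by omega, by omega⟩
      · have e1 : (k + 1) / 2 = k / 2 + 1 := by omega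
        have e2 : (k + 1) % 2 = 0 := by omega
        rw [e1, e2] at hc'; rw [e1] at hr'; rw [hk] at hc
        right; exact ⟨by omega, Or.inr ⟨by omega, by omega⟩⟩
    · obtain ⟨hc', hr'⟩ := shape_bot (J := J) (i := 1 + J % 2 + 2 * J + 3 + k + 1) (by omega)
      have hk : k = 2 * J - 1 := by omega
      have e1 : k / 2 = J - 1 := by omega
      have e2 : k % 2 = 1 := by omega
      rw [e1, e2] at hc; rw [e1] at hr
      right; exact ⟨by omega, Or.inr ⟨by omega, by omega⟩⟩
  · -- region 5 → 6
    obtain ⟨hc, hr⟩ := shape_bot (J := J) (i := i) (by omega)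
    obtain ⟨hc', hr'⟩ := shape_last' (J := J) (i := i + 1) (by omega)
    left; exact ⟨by omega, Or.inl (by omega)⟩

/-- **The excursion visits no point twice.** [cite: MadrasSlade1993, Theorem 8.2.1 (8.2.13), p. 269 (statement; the insertion here is the lane's proof, not the printed one)] -/
theorem shape_inj {J i i' : ℕ} (hi : i < 4 * J + 6) (hi' : i' < 4 * J + 6) (hc : zcol J i = zcol J i')
    (hr : zrow J i = zrow J i') : i = i' := by
  have h := shape_cases hi
  have h' := shape_cases hi'
  rcases h with h | h | h | h | h | h | h <;> rcases h' with h' | h' | h' | h' | h' | h' | h' <;> omega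

/-! ### The excursion as a list of sites -/

/-- The excursion of the top strand inside the inserted block with left column `x = σ c`, base row `z`,
`J = T − z` rows to climb: `4J + 6` points from `(x+1, z)` to `(x+4, z)`. [cite: MadrasSlade1993, Theorem 8.2.1 (8.2.13), p. 269 (statement; the insertion here is the lane's proof, not the printed one)] -/
def zig (x z : ℤ) (J : ℕ) : List (Site 2) :=
  (List.range (4 * J + 6)).map fun i => mk (x + zcol J i) (z + zrow J i)

/-- The excursion has `4J + 6` points. [cite: MadrasSlade1993, Theorem 8.2.1 (8.2.13), p. 269 (statement; the insertion here is the lane's proof, not the printed one)] -/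
theorem length_zig (x z : ℤ) (J : ℕ) : (zig x z J).length = 4 * J + 6 := by
  simp [zig]

/-- The excursion is non-empty. [cite: MadrasSlade1993, Theorem 8.2.1 (8.2.13), p. 269 (statement; the insertion here is the lane's proof, not the printed one)] -/
theorem zig_ne_nil (x z : ℤ) (J : ℕ) : zig x z J ≠ [] := by
  rw [← List.length_pos_iff_ne_nil, length_zig]; omega

/-- Membership in the excursion. [cite: MadrasSlade1993, Theorem 8.2.1 (8.2.13), p. 269 (statement; the insertion here is the lane's proof, not the printed one)] -/
theorem mem_zig {x z : ℤ} {J : ℕ} {p : Site 2} :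
    p ∈ zig x z J ↔ ∃ i < 4 * J + 6, mk (x + zcol J i) (z + zrow J i) = p := by
  simp only [zig, List.mem_map, List.mem_range]

/-- Where the points of the excursion live: columns `x+1…x+4`, rows `z…z+J+1`, and only `x+1, x+2, x+3`
in the top row. [cite: MadrasSlade1993, Theorem 8.2.1 (8.2.13), p. 269 (statement; the insertion here is the lane's proof, not the printed one)] -/
theorem mem_zig_bounds {x z : ℤ} {J : ℕ} {p : Site 2} (hp : p ∈ zig x z J) :
    x + 1 ≤ p 0 ∧ p 0 ≤ x + 4 ∧ z ≤ p 1 ∧ p 1 ≤ z + J + 1 ∧ (p 1 = z + J + 1 → p 0 ≤ x + 3) := by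
  obtain ⟨i, hi, rfl⟩ := mem_zig.1 hp
  have h1 := shape_range J i
  have h2 := @zcol_le_three_of_top J i
  simp only [mk_zero, mk_one]
  refine ⟨by omega, by omega, by omega, by omega, fun h => ?_⟩
  have := h2 (by omega)
  omega

/-- The three top points `(x+j, z+J+1)`, `j = 1,2,3`, belong to the excursion. [cite: MadrasSlade1993, Theorem 8.2.1 (8.2.13), p. 269 (statement; the insertion here is the lane's proof, not the printed one)] -/
theorem top_mem_zig (x z : ℤ) (J : ℕ) {j : ℕ} (hj1 : 1 ≤ j) (hj3 : j ≤ 3) :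
    mk (x + j) (z + J + 1) ∈ zig x z J := by
  obtain ⟨i, hi, hc, hr⟩ := exists_top J hj1 hj3
  refine mem_zig.2 ⟨i, hi, ?_⟩
  rw [hc, hr]; push_cast; ring_nf

/-- The excursion is duplicate-free. [cite: MadrasSlade1993, Theorem 8.2.1 (8.2.13), p. 269 (statement; the insertion here is the lane's proof, not the printed one)] -/
theorem nodup_zig (x z : ℤ) (J : ℕ) : (zig x z J).Nodup := by
  refine List.Nodup.map_on (fun i hi i' hi' h => ?_) List.nodup_range
  rw [List.mem_range] at hi hi'
  obtain ⟨hc, hr⟩ := mk_inj.1 h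
  exact shape_inj hi hi' (by omega) (by omega)

/-- A `map` over `range` is a chain when consecutive values are related. [cite: MadrasSlade1993, Theorem 8.2.1 (8.2.13), p. 269 (statement; the insertion here is the lane's proof, not the printed one)] -/
theorem isChain_map_range {α : Type*} {S : α → α → Prop} (f : ℕ → α) (m : ℕ)
    (h : ∀ j, j + 1 < m → S (f j) (f (j + 1))) : ((List.range m).map f).IsChain S := by
  rw [List.isChain_map]
  cases m with
  | zero => simp
  | succ m => exact (List.isChain_range_succ _ m).2 fun j hj => h j (by omega)

/-- The head of `(range (m+1)).map f`. [cite: MadrasSlade1993, Theorem 8.2.1 (8.2.13), p. 269 (statement; the insertion here is the lane's proof, not the printed one)] -/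
private theorem head?_map_range_succ {α : Type*} (f : ℕ → α) (m : ℕ) :
    ((List.range (m + 1)).map f).head? = some (f 0) := by
  rw [List.range_succ_eq_map]; rfl

/-- The last element of `(range (m+1)).map f`. [cite: MadrasSlade1993, Theorem 8.2.1 (8.2.13), p. 269 (statement; the insertion here is the lane's proof, not the printed one)] -/
private theorem getLast?_map_range_succ {α : Type*} (f : ℕ → α) (m : ℕ) :
    ((List.range (m + 1)).map f).getLast? = some (f m) := by
  rw [List.range_succ, List.map_append, List.map_singleton, List.getLast?_append,
    List.getLast?_singleton, Option.some_or]

/-- **The excursion is a brick-wall chain** when `B₁ + T = (x + 1) + (z + J)` is even. [cite: MadrasSlade1993, Theorem 8.2.1 (8.2.13), p. 269 (statement; the insertion here is the lane's proof, not the printed one)] -/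
theorem isChain_zig {x z : ℤ} {J : ℕ} (hpar : (x + 1 + z + J) % 2 = 0) :
    (zig x z J).IsChain brickWallGraph.Adj := by
  refine isChain_map_range _ _ fun i hi => ?_
  rw [adj_mk_iff]
  have := shape_step hi
  omega

/-- The reversed excursion is a brick-wall chain. [cite: MadrasSlade1993, Theorem 8.2.1 (8.2.13), p. 269 (statement; the insertion here is the lane's proof, not the printed one)] -/
theorem isChain_reverse_zig {x z : ℤ} {J : ℕ} (hpar : (x + 1 + z + J) % 2 = 0) :
    (zig x z J).reverse.IsChain brickWallGraph.Adj := by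
  rw [List.isChain_reverse]
  exact (isChain_zig hpar).imp fun a b h => h.symm

/-- The first point of the excursion is `(x+1, z)`. [cite: MadrasSlade1993, Theorem 8.2.1 (8.2.13), p. 269 (statement; the insertion here is the lane's proof, not the printed one)] -/
theorem head?_zig (x z : ℤ) (J : ℕ) : (zig x z J).head? = some (mk (x + 1) z) := by
  rw [zig, show 4 * J + 6 = (4 * J + 5) + 1 by ring, head?_map_range_succ, (shape_zero J).1,
    (shape_zero J).2]
  simp

/-- The last point of the excursion is `(x+4, z)`. [cite: MadrasSlade1993, Theorem 8.2.1 (8.2.13), p. 269 (statement; the insertion here is the lane's proof, not the printed one)] -/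
theorem getLast?_zig (x z : ℤ) (J : ℕ) : (zig x z J).getLast? = some (mk (x + 4) z) := by
  rw [zig, show 4 * J + 6 = (4 * J + 5) + 1 by ring, getLast?_map_range_succ, (shape_last J).1,
    (shape_last J).2]
  simp

/-- The first point of the reversed excursion is `(x+4, z)`. [cite: MadrasSlade1993, Theorem 8.2.1 (8.2.13), p. 269 (statement; the insertion here is the lane's proof, not the printed one)] -/
theorem head?_reverse_zig (x z : ℤ) (J : ℕ) : (zig x z J).reverse.head? = some (mk (x + 4) z) := by
  rw [List.head?_reverse, getLast?_zig]

/-- The last point of the reversed excursion is `(x+1, z)`. [cite: MadrasSlade1993, Theorem 8.2.1 (8.2.13), p. 269 (statement; the insertion here is the lane's proof, not the printed one)] -/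
theorem getLast?_reverse_zig (x z : ℤ) (J : ℕ) : (zig x z J).reverse.getLast? = some (mk (x + 1) z) := by
  rw [List.getLast?_reverse, head?_zig]


/-! ### Crossing steps, cuts, top strands (placed walk `ω`, `n` steps) -/

variable (ω : ℕ → Site 2) (n : ℕ)

/-- Step `t` of `ω` crosses the cut between the columns `c` and `c + 1`. [cite: MadrasSlade1993, Theorem 8.2.1 (8.2.13), p. 269 (statement; the insertion here is the lane's proof, not the printed one)] -/
def Crosses (t : ℕ) (c : ℤ) : Prop :=
  (ω t 0 = c ∧ ω (t + 1) 0 = c + 1) ∨ (ω t 0 = c + 1 ∧ ω (t + 1) 0 = c)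

/-- `Crosses` is decidable. [cite: MadrasSlade1993, Theorem 8.2.1 (8.2.13), p. 269 (statement; the insertion here is the lane's proof, not the printed one)] -/
instance (t : ℕ) (c : ℤ) : Decidable (Crosses ω t c) := by
  unfold Crosses; infer_instance

/-- The cut crossed by a horizontal step `t`. [cite: MadrasSlade1993, Theorem 8.2.1 (8.2.13), p. 269 (statement; the insertion here is the lane's proof, not the printed one)] -/
def cutOf (t : ℕ) : ℤ := min (ω t 0) (ω (t + 1) 0)

/-- The times `< n` at which `ω` crosses the cut `c`. [cite: MadrasSlade1993, Theorem 8.2.1 (8.2.13), p. 269 (statement; the insertion here is the lane's proof, not the printed one)] -/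
def crossTimes (c : ℤ) : Finset ℕ := (Finset.range n).filter fun t => Crosses ω t c

/-- The cuts crossed by the first `n` steps of `ω` (for the placed walk `t ↦ a + υ t` this is the tree's
`HexBW.cuts a υ n`, definitionally). [cite: MadrasSlade1993, Theorem 8.2.1 (8.2.13), p. 269 (statement; the insertion here is the lane's proof, not the printed one)] -/
def cutsP : Finset ℤ :=
  ((Finset.range n).filter fun t => ω t 0 ≠ ω (t + 1) 0).image (cutOf ω)

/-- Step `t` is a crossing of `c` of maximal row (the TOP strand of the cut). [cite: MadrasSlade1993, Theorem 8.2.1 (8.2.13), p. 269 (statement; the insertion here is the lane's proof, not the printed one)] -/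
def IsTop (c : ℤ) (t : ℕ) : Prop := ∀ t' ∈ crossTimes ω n c, ω t' 1 ≤ ω t 1

/-- `IsTop` is decidable. [cite: MadrasSlade1993, Theorem 8.2.1 (8.2.13), p. 269 (statement; the insertion here is the lane's proof, not the printed one)] -/
instance (c : ℤ) (t : ℕ) : Decidable (IsTop ω n c t) := by
  unfold IsTop; infer_instance

variable {ω n}

/-- Membership in `crossTimes`. [cite: MadrasSlade1993, Theorem 8.2.1 (8.2.13), p. 269 (statement; the insertion here is the lane's proof, not the printed one)] -/
theorem mem_crossTimes {c : ℤ} {t : ℕ} : t ∈ crossTimes ω n c ↔ t < n ∧ Crosses ω t c := by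
  simp [crossTimes]

/-- A crossing step changes column. [cite: MadrasSlade1993, Theorem 8.2.1 (8.2.13), p. 269 (statement; the insertion here is the lane's proof, not the printed one)] -/
theorem Crosses.ne {t : ℕ} {c : ℤ} (h : Crosses ω t c) : ω t 0 ≠ ω (t + 1) 0 := by
  rcases h with ⟨h1, h2⟩ | ⟨h1, h2⟩ <;> omega

/-- A crossing step of `c` has cut `c`. [cite: MadrasSlade1993, Theorem 8.2.1 (8.2.13), p. 269 (statement; the insertion here is the lane's proof, not the printed one)] -/
theorem Crosses.cutOf_eq {t : ℕ} {c : ℤ} (h : Crosses ω t c) : cutOf ω t = c := by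
  unfold cutOf
  rcases h with ⟨h1, h2⟩ | ⟨h1, h2⟩ <;> rw [h1, h2] <;> simp

/-- A brick-wall step with different columns is a crossing of its cut, at constant row. [cite: MadrasSlade1993, Theorem 8.2.1 (8.2.13), p. 269 (statement; the insertion here is the lane's proof, not the printed one)] -/
theorem crosses_cutOf_of_ne {t : ℕ} (hadj : brickWallGraph.Adj (ω t) (ω (t + 1)))
    (hne : ω t 0 ≠ ω (t + 1) 0) : Crosses ω t (cutOf ω t) ∧ ω t 1 = ω (t + 1) 1 := by
  rw [brickWallGraph_adj_coord] at hadj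
  rcases hadj with ⟨h0 | h0, h1⟩ | ⟨h0, _⟩
  · refine ⟨Or.inl ⟨?_, ?_⟩, h1.symm⟩ <;> simp [cutOf, h0]
  · refine ⟨Or.inr ⟨?_, ?_⟩, h1.symm⟩ <;> simp [cutOf, h0]
  · exact absurd h0.symm hne

/-- Membership in `cutsP`. [cite: MadrasSlade1993, Theorem 8.2.1 (8.2.13), p. 269 (statement; the insertion here is the lane's proof, not the printed one)] -/
theorem mem_cutsP {c : ℤ} : c ∈ cutsP ω n ↔ ∃ t < n, ω t 0 ≠ ω (t + 1) 0 ∧ cutOf ω t = c := by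
  simp [cutsP, and_assoc]

/-- A cut of a brick-wall walk has a crossing time. [cite: MadrasSlade1993, Theorem 8.2.1 (8.2.13), p. 269 (statement; the insertion here is the lane's proof, not the printed one)] -/
theorem crossTimes_nonempty (hadj : ∀ t < n, brickWallGraph.Adj (ω t) (ω (t + 1))) {c : ℤ}
    (hc : c ∈ cutsP ω n) : (crossTimes ω n c).Nonempty := by
  obtain ⟨t, ht, hne, rfl⟩ := mem_cutsP.1 hc
  exact ⟨t, mem_crossTimes.2 ⟨ht, (crosses_cutOf_of_ne (hadj t ht) hne).1⟩⟩

/-- Every cut of a brick-wall walk has a top crossing. [cite: MadrasSlade1993, Theorem 8.2.1 (8.2.13), p. 269 (statement; the insertion here is the lane's proof, not the printed one)] -/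
theorem exists_isTop (hadj : ∀ t < n, brickWallGraph.Adj (ω t) (ω (t + 1))) {c : ℤ}
    (hc : c ∈ cutsP ω n) : ∃ t ∈ crossTimes ω n c, IsTop ω n c t :=
  Finset.exists_max_image _ (fun t => ω t 1) (crossTimes_nonempty hadj hc)

/-- Two crossings of the same cut at the same row are the same step (self-avoidance). [cite: MadrasSlade1993, Theorem 8.2.1 (8.2.13), p. 269 (statement; the insertion here is the lane's proof, not the printed one)] -/
theorem crossTimes_row_inj (hinj : Set.InjOn ω {i | i ≤ n})
    (hrow : ∀ t < n, ω t 0 ≠ ω (t + 1) 0 → ω t 1 = ω (t + 1) 1) {c : ℤ} {t t' : ℕ}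
    (ht : t ∈ crossTimes ω n c) (ht' : t' ∈ crossTimes ω n c) (h : ω t 1 = ω t' 1) : t = t' := by
  obtain ⟨htn, htc⟩ := mem_crossTimes.1 ht
  obtain ⟨htn', htc'⟩ := mem_crossTimes.1 ht'
  have hr := hrow t htn htc.ne
  have hr' := hrow t' htn' htc'.ne
  rcases htc with ⟨a1, a2⟩ | ⟨a1, a2⟩ <;> rcases htc' with ⟨b1, b2⟩ | ⟨b1, b2⟩
  · have : ω t = ω t' := by rw [eq_mk (ω t), eq_mk (ω t'), a1, b1, h]
    exact hinj (by show t ≤ n; omega) (by show t' ≤ n; omega) this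
  · have e1 : ω t = ω (t' + 1) := by rw [eq_mk (ω t), eq_mk (ω (t' + 1)), a1, b2, h, hr']
    have e2 : ω (t + 1) = ω t' := by rw [eq_mk (ω (t + 1)), eq_mk (ω t'), a2, b1, ← hr, h]
    have := hinj (by show t ≤ n; omega) (by show t' + 1 ≤ n; omega) e1
    have := hinj (by show t + 1 ≤ n; omega) (by show t' ≤ n; omega) e2
    omega
  · have e1 : ω t = ω (t' + 1) := by rw [eq_mk (ω t), eq_mk (ω (t' + 1)), a1, b2, h, hr']
    have e2 : ω (t + 1) = ω t' := by rw [eq_mk (ω (t + 1)), eq_mk (ω t'), a2, b1, ← hr, h]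
    have := hinj (by show t ≤ n; omega) (by show t' + 1 ≤ n; omega) e1
    have := hinj (by show t + 1 ≤ n; omega) (by show t' ≤ n; omega) e2
    omega
  · have : ω t = ω t' := by rw [eq_mk (ω t), eq_mk (ω t'), a1, b1, h]
    exact hinj (by show t ≤ n; omega) (by show t' ≤ n; omega) this

/-! ### The blocks and the image list -/

/-- The block of image points replacing the step `t` (not including the next anchor): the anchor `σ(ω t)`
alone; or, for a crossing of a cut `c ∈ R` from column `σ(ω t)` in the direction `d = ±1`, the anchor
followed by the four stretched points (non-top strand) or by the excursion of the top strand (traversed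
forwards for `d = 1`, backwards for `d = -1`). [cite: MadrasSlade1993, Theorem 8.2.1 (8.2.13), p. 269 (statement; the insertion here is the lane's proof, not the printed one)] -/
def block (T : ℕ) (x₀ : ℤ) (R : Finset ℤ) (ω : ℕ → Site 2) (n t : ℕ) : List (Site 2) :=
  if ω t 0 ≠ ω (t + 1) 0 ∧ cutOf ω t ∈ R then
    if IsTop ω n (cutOf ω t) t then
      smap x₀ R (ω t) ::
        (if ω t 0 < ω (t + 1) 0 then zig (colMap x₀ R (cutOf ω t)) (ω t 1) (T - (ω t 1).toNat)
          else (zig (colMap x₀ R (cutOf ω t)) (ω t 1) (T - (ω t 1).toNat)).reverse)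
    else
      [smap x₀ R (ω t), mk (colMap x₀ R (ω t 0) + (ω (t + 1) 0 - ω t 0)) (ω t 1),
        mk (colMap x₀ R (ω t 0) + 2 * (ω (t + 1) 0 - ω t 0)) (ω t 1),
        mk (colMap x₀ R (ω t 0) + 3 * (ω (t + 1) 0 - ω t 0)) (ω t 1),
        mk (colMap x₀ R (ω t 0) + 4 * (ω (t + 1) 0 - ω t 0)) (ω t 1)]
  else [smap x₀ R (ω t)]

/-- The image list `Ψ(ω, R)`: the blocks of the steps `0, …, n-1`, then the last anchor. [cite: MadrasSlade1993, Theorem 8.2.1 (8.2.13), p. 269 (statement; the insertion here is the lane's proof, not the printed one)] -/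
def imageList (T : ℕ) (x₀ : ℤ) (R : Finset ℤ) (ω : ℕ → Site 2) (n : ℕ) : List (Site 2) :=
  (List.range n).flatMap (block T x₀ R ω n) ++ [smap x₀ R (ω n)]

/-- The extra length of the block of step `t` (for a crossing step of a cut in `R`). [cite: MadrasSlade1993, Theorem 8.2.1 (8.2.13), p. 269 (statement; the insertion here is the lane's proof, not the printed one)] -/
def extra (T : ℕ) (ω : ℕ → Site 2) (n : ℕ) (c : ℤ) (t : ℕ) : ℕ :=
  if IsTop ω n c t then 4 * (T - (ω t 1).toNat) + 6 else 4

/-- The cost of the cut `c`: the total extra length of the blocks of its crossings. [cite: MadrasSlade1993, Theorem 8.2.1 (8.2.13), p. 269 (statement; the insertion here is the lane's proof, not the printed one)] -/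
def cost (T : ℕ) (ω : ℕ → Site 2) (n : ℕ) (c : ℤ) : ℕ :=
  ∑ t ∈ crossTimes ω n c, extra T ω n c t

/-- Blocks are non-empty. [cite: MadrasSlade1993, Theorem 8.2.1 (8.2.13), p. 269 (statement; the insertion here is the lane's proof, not the printed one)] -/
theorem block_ne_nil (T : ℕ) (x₀ : ℤ) (R : Finset ℤ) (ω : ℕ → Site 2) (n t : ℕ) :
    block T x₀ R ω n t ≠ [] := by
  unfold block; split_ifs <;> simp

/-- Every block starts with the anchor `σ(ω t)`. [cite: MadrasSlade1993, Theorem 8.2.1 (8.2.13), p. 269 (statement; the insertion here is the lane's proof, not the printed one)] -/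
theorem head?_block (T : ℕ) (x₀ : ℤ) (R : Finset ℤ) (ω : ℕ → Site 2) (n t : ℕ) :
    (block T x₀ R ω n t).head? = some (smap x₀ R (ω t)) := by
  unfold block; split_ifs <;> simp

/-! ### Strip walks -/

/-- The standing hypotheses: `ω` is an `n`-step self-avoiding brick-wall walk in the strip `0 ≤ row ≤ T`.
[cite: MadrasSlade1993, Theorem 8.2.1 (8.2.13), p. 269 (statement; the insertion here is the lane's proof, not the printed one)] -/
structure StripWalk (T : ℕ) (ω : ℕ → Site 2) (n : ℕ) : Prop where
  adj : ∀ t < n, brickWallGraph.Adj (ω t) (ω (t + 1))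
  inj : Set.InjOn ω {i | i ≤ n}
  row_nonneg : ∀ t ≤ n, 0 ≤ ω t 1
  row_le : ∀ t ≤ n, ω t 1 ≤ (T : ℤ)

variable {T : ℕ} {x₀ : ℤ} {R : Finset ℤ}

/-- A horizontal step of a strip walk keeps the row. [cite: MadrasSlade1993, Theorem 8.2.1 (8.2.13), p. 269 (statement; the insertion here is the lane's proof, not the printed one)] -/
theorem StripWalk.row_eq (hW : StripWalk T ω n) {t : ℕ} (ht : t < n) (hne : ω t 0 ≠ ω (t + 1) 0) :
    ω t 1 = ω (t + 1) 1 :=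
  (crosses_cutOf_of_ne (hW.adj t ht) hne).2

/-- Horizontal steps of a strip walk keep the row (all steps). [cite: MadrasSlade1993, Theorem 8.2.1 (8.2.13), p. 269 (statement; the insertion here is the lane's proof, not the printed one)] -/
theorem StripWalk.rows (hW : StripWalk T ω n) : ∀ t < n, ω t 0 ≠ ω (t + 1) 0 → ω t 1 = ω (t + 1) 1 :=
  fun _ ht hne => hW.row_eq ht hne

/-- The geometry of a crossing step of a cut `c = cutOf ω t ∈ R`: with `d = ±1` the step direction,
`σ(col ω t) = σ c` (`d = 1`) or `σ c + 5` (`d = -1`), and the next anchor column is `σ(col ω t) + 5d`. [cite: MadrasSlade1993, Theorem 8.2.1 (8.2.13), p. 269 (statement; the insertion here is the lane's proof, not the printed one)] -/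
theorem crossing_geometry (hW : StripWalk T ω n) {t : ℕ} (ht : t < n) (hne : ω t 0 ≠ ω (t + 1) 0)
    (hR : cutOf ω t ∈ R) :
    ((ω (t + 1) 0 - ω t 0 = 1 ∧ colMap x₀ R (ω t 0) = colMap x₀ R (cutOf ω t)) ∨
      (ω (t + 1) 0 - ω t 0 = -1 ∧ colMap x₀ R (ω t 0) = colMap x₀ R (cutOf ω t) + 5)) ∧
    colMap x₀ R (ω (t + 1) 0) = colMap x₀ R (ω t 0) + 5 * (ω (t + 1) 0 - ω t 0) := by
  have hc := (crosses_cutOf_of_ne (hW.adj t ht) hne).1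
  have h5 := colMap_succ_of_mem (x₀ := x₀) hR
  rcases hc with ⟨h1, h2⟩ | ⟨h1, h2⟩
  · rw [h1, h2]
    exact ⟨Or.inl ⟨by ring, rfl⟩, by rw [h5]; ring⟩
  · rw [h1, h2, h5]
    exact ⟨Or.inr ⟨by ring, rfl⟩, by ring⟩

/-- `J = T − row` and the top row: `row + J = T` for a strip walk. [cite: MadrasSlade1993, Theorem 8.2.1 (8.2.13), p. 269 (statement; the insertion here is the lane's proof, not the printed one)] -/
theorem StripWalk.row_add (hW : StripWalk T ω n) {t : ℕ} (ht : t ≤ n) :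
    ω t 1 + ((T - (ω t 1).toNat : ℕ) : ℤ) = (T : ℤ) := by
  have h0 := hW.row_nonneg t ht
  have hT := hW.row_le t ht
  have e := Int.toNat_of_nonneg h0
  have : (ω t 1).toNat ≤ T := by omega
  push_cast [this]
  omega

/-- Where the points of a block live: the anchor `σ(ω t)`, or an inserted point of the cut `c = cutOf ω t ∈ R`
in one of the four inserted columns `σ c + 1 … σ c + 4`, at the row of the strand (stretched strand) or in the
rows `row(ω t) … T + 1` (excursion of the top strand), and in the top row `T + 1` only in the columns
`σ c + 1 … σ c + 3`. [cite: MadrasSlade1993, Theorem 8.2.1 (8.2.13), p. 269 (statement; the insertion here is the lane's proof, not the printed one)] -/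
theorem mem_block (hW : StripWalk T ω n) {t : ℕ} (ht : t < n) {z : Site 2} (hz : z ∈ block T x₀ R ω n t) :
    z = smap x₀ R (ω t) ∨
    (ω t 0 ≠ ω (t + 1) 0 ∧ cutOf ω t ∈ R ∧
      (colMap x₀ R (cutOf ω t) + 1 ≤ z 0 ∧ z 0 ≤ colMap x₀ R (cutOf ω t) + 4) ∧
      ω t 1 ≤ z 1 ∧ z 1 ≤ (T : ℤ) + 1 ∧ (¬ IsTop ω n (cutOf ω t) t → z 1 = ω t 1) ∧
      (z 1 = (T : ℤ) + 1 → z 0 ≤ colMap x₀ R (cutOf ω t) + 3)) := by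
  unfold block at hz
  split_ifs at hz with h1 h2 h3
  · -- excursion, forwards
    rcases List.mem_cons.1 hz with rfl | hz
    · exact Or.inl rfl
    · right
      have hb := mem_zig_bounds hz
      have e := hW.row_add ht.le
      refine ⟨h1.1, h1.2, ⟨hb.1, hb.2.1⟩, hb.2.2.1, by omega, fun h => absurd h2 h, fun h => hb.2.2.2.2 (by omega)⟩
  · -- excursion, backwards
    rcases List.mem_cons.1 hz with rfl | hz
    · exact Or.inl rfl
    · right
      rw [List.mem_reverse] at hz
      have hb := mem_zig_bounds hz
      have e := hW.row_add ht.le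
      refine ⟨h1.1, h1.2, ⟨hb.1, hb.2.1⟩, hb.2.2.1, by omega, fun h => absurd h2 h, fun h => hb.2.2.2.2 (by omega)⟩
  · -- stretched strand
    obtain ⟨hg, -⟩ := crossing_geometry (x₀ := x₀) hW ht h1.1 h1.2
    have hL := hW.row_le t ht.le
    simp only [List.mem_cons, List.not_mem_nil, or_false] at hz
    rcases hz with rfl | rfl | rfl | rfl | rfl
    · exact Or.inl rfl
    all_goals
      right
      refine ⟨h1.1, h1.2, ?_, by simp, by simp; omega, fun _ => by simp, fun h => by simp at h; omega⟩
      rcases hg with ⟨g1, g2⟩ | ⟨g1, g2⟩ <;> simp only [mk_zero] <;> omega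
  · simp only [List.mem_singleton] at hz
    exact Or.inl hz

/-- All block points lie in the rows `0 … T+1`. [cite: MadrasSlade1993, Theorem 8.2.1 (8.2.13), p. 269 (statement; the insertion here is the lane's proof, not the printed one)] -/
theorem row_mem_block (hW : StripWalk T ω n) {t : ℕ} (ht : t < n) {z : Site 2}
    (hz : z ∈ block T x₀ R ω n t) : 0 ≤ z 1 ∧ z 1 ≤ (T : ℤ) + 1 := by
  rcases mem_block hW ht hz with rfl | ⟨-, -, -, h1, h2, -⟩
  · exact ⟨by simpa using hW.row_nonneg t ht.le, by simp; have := hW.row_le t ht.le; omega⟩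
  · exact ⟨(hW.row_nonneg t ht.le).trans h1, h2⟩

/-- No anchor column is an inserted column (interval form). [cite: MadrasSlade1993, Theorem 8.2.1 (8.2.13), p. 269 (statement; the insertion here is the lane's proof, not the printed one)] -/
theorem colMap_not_ins {c : ℤ} (hc : c ∈ R) (x : ℤ) :
    ¬ (colMap x₀ R c + 1 ≤ colMap x₀ R x ∧ colMap x₀ R x ≤ colMap x₀ R c + 4) := by
  rintro ⟨h1, h2⟩
  rcases le_or_gt x c with hxc | hxc
  · have := (colMap_le_iff x₀ R).2 hxc; omega
  · have h3 : c + 1 ≤ x := hxc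
    have := (colMap_le_iff x₀ R).2 h3
    rw [colMap_succ_of_mem hc] at this; omega

/-- Inserted columns of a smaller cut lie to the left of those of a larger cut. [cite: MadrasSlade1993, Theorem 8.2.1 (8.2.13), p. 269 (statement; the insertion here is the lane's proof, not the printed one)] -/
theorem ins_lt_ins {c c' : ℤ} (hc : c ∈ R) (hcc : c < c') : colMap x₀ R c + 4 < colMap x₀ R c' + 1 := by
  have h1 : c + 1 ≤ c' := hcc
  have := (colMap_le_iff x₀ R).2 h1
  rw [colMap_succ_of_mem hc] at this; omega

/-- Each block is duplicate-free. [cite: MadrasSlade1993, Theorem 8.2.1 (8.2.13), p. 269 (statement; the insertion here is the lane's proof, not the printed one)] -/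
theorem nodup_block (hW : StripWalk T ω n) {t : ℕ} (ht : t < n) : (block T x₀ R ω n t).Nodup := by
  unfold block
  split_ifs with h1 h2 h3
  · refine List.nodup_cons.2 ⟨fun hmem => ?_, nodup_zig _ _ _⟩
    have hb := mem_zig_bounds hmem
    simp only [smap_zero] at hb
    exact colMap_not_ins h1.2 (ω t 0) ⟨hb.1, hb.2.1⟩
  · refine List.nodup_cons.2 ⟨fun hmem => ?_, List.nodup_reverse.2 (nodup_zig _ _ _)⟩
    rw [List.mem_reverse] at hmem
    have hb := mem_zig_bounds hmem
    simp only [smap_zero] at hb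
    exact colMap_not_ins h1.2 (ω t 0) ⟨hb.1, hb.2.1⟩
  · obtain ⟨hg, -⟩ := crossing_geometry (x₀ := x₀) hW ht h1.1 h1.2
    have hd0 : ω (t + 1) 0 - ω t 0 = 1 ∨ ω (t + 1) 0 - ω t 0 = -1 := by
      rcases hg with ⟨g, -⟩ | ⟨g, -⟩
      · exact Or.inl g
      · exact Or.inr g
    refine List.Nodup.of_map (fun p : Site 2 => p 0) ?_
    simp only [List.map_cons, List.map_nil, smap_zero, mk_zero, List.nodup_cons, List.mem_cons,
      List.not_mem_nil, or_false, not_or, List.nodup_nil, and_true, not_false_eq_true]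
    omega
  · exact List.nodup_singleton _

/-- Distinct blocks are disjoint. [cite: MadrasSlade1993, Theorem 8.2.1 (8.2.13), p. 269 (statement; the insertion here is the lane's proof, not the printed one)] -/
theorem disjoint_block (hW : StripWalk T ω n) {t t' : ℕ} (ht : t < n) (ht' : t' < n) (htt : t ≠ t') :
    List.Disjoint (block T x₀ R ω n t) (block T x₀ R ω n t') := by
  intro z hz hz'
  rcases mem_block hW ht hz with rfl | ⟨hne, hR, hcol, hr1, hr2, hr3, -⟩ <;>
    rcases mem_block hW ht' hz' with h | ⟨hne', hR', hcol', hr1', hr2', hr3', -⟩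
  · exact htt (hW.inj (by show t ≤ n; omega) (by show t' ≤ n; omega) (smap_injective x₀ R h))
  · exact colMap_not_ins hR' (ω t 0) (by simpa using hcol')
  · rw [h] at hcol
    exact colMap_not_ins hR (ω t' 0) (by simpa using hcol)
  · -- two inserted points
    by_cases hcc : cutOf ω t = cutOf ω t'
    · -- same cut: compare rows
      have hx : t ∈ crossTimes ω n (cutOf ω t) :=
        mem_crossTimes.2 ⟨ht, (crosses_cutOf_of_ne (hW.adj t ht) hne).1⟩
      have hx' : t' ∈ crossTimes ω n (cutOf ω t) := by
        rw [hcc]; exact mem_crossTimes.2 ⟨ht', (crosses_cutOf_of_ne (hW.adj t' ht') hne').1⟩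
      have hrr : ω t 1 ≠ ω t' 1 := fun h => htt (crossTimes_row_inj hW.inj hW.rows hx hx' h)
      by_cases hT : IsTop ω n (cutOf ω t) t
      · have h1 := hT t' hx'
        by_cases hT' : IsTop ω n (cutOf ω t') t'
        · have h2 := hT' t (by rw [← hcc]; exact hx)
          omega
        · have := hr3' hT'; omega
      · have h1 := hr3 hT
        by_cases hT' : IsTop ω n (cutOf ω t') t'
        · have h2 := hT' t (by rw [← hcc]; exact hx)
          omega
        · have := hr3' hT'; omega
    · rcases lt_or_gt_of_ne hcc with hlt | hlt
      · have := ins_lt_ins (x₀ := x₀) hR hlt; omega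
      · have := ins_lt_ins (x₀ := x₀) hR' hlt; omega

/-- The final anchor is in no block. [cite: MadrasSlade1993, Theorem 8.2.1 (8.2.13), p. 269 (statement; the insertion here is the lane's proof, not the printed one)] -/
theorem last_not_mem_block (hW : StripWalk T ω n) {t : ℕ} (ht : t < n) :
    smap x₀ R (ω n) ∉ block T x₀ R ω n t := by
  intro hz
  rcases mem_block hW ht hz with h | ⟨-, hR, hcol, -⟩
  · have := hW.inj (by show n ≤ n; omega) (by show t ≤ n; omega) (smap_injective x₀ R h)
    omega
  · exact colMap_not_ins hR (ω n 0) (by simpa using hcol)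

/-- **The image list has no repeated point.** [cite: MadrasSlade1993, Theorem 8.2.1 (8.2.13), p. 269 (statement; the insertion here is the lane's proof, not the printed one)] -/
theorem nodup_imageList (hW : StripWalk T ω n) (R : Finset ℤ) : (imageList T x₀ R ω n).Nodup := by
  rw [imageList, List.nodup_append]
  refine ⟨?_, List.nodup_singleton _, ?_⟩
  · rw [List.nodup_flatMap]
    refine ⟨fun t ht => nodup_block hW (List.mem_range.1 ht), ?_⟩
    exact List.pairwise_lt_range.imp_of_mem fun {t t'} ht ht' hlt =>
      disjoint_block hW (List.mem_range.1 ht) (List.mem_range.1 ht') hlt.ne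
  · intro z hz z' hz' hzz
    rw [List.mem_singleton] at hz'
    subst hzz; subst hz'
    obtain ⟨t, ht, hzt⟩ := List.mem_flatMap.1 hz
    exact last_not_mem_block hW (List.mem_range.1 ht) hzt

/-! ### The image list is a brick-wall chain -/

/-- Parity at an admissible cut: `σ c + 1 + row + (T − row)` is even when `c + T` is odd. [cite: MadrasSlade1993, Theorem 8.2.1 (8.2.13), p. 269 (statement; the insertion here is the lane's proof, not the printed one)] -/
theorem parity_of_admissible (hW : StripWalk T ω n) {t : ℕ} (ht : t ≤ n) {c : ℤ} (hc : (c + (T : ℤ)) % 2 = 1) :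
    (colMap x₀ R c + 1 + ω t 1 + ((T - (ω t 1).toNat : ℕ) : ℤ)) % 2 = 0 := by
  obtain ⟨k, hk⟩ := colMap_eq_add x₀ R c
  have e := hW.row_add ht
  omega

/-- Each block is a brick-wall chain (cuts of `R` admissible). [cite: MadrasSlade1993, Theorem 8.2.1 (8.2.13), p. 269 (statement; the insertion here is the lane's proof, not the printed one)] -/
theorem isChain_block (hW : StripWalk T ω n) (hRad : ∀ c ∈ R, (c + (T : ℤ)) % 2 = 1) {t : ℕ} (ht : t < n) :
    (block T x₀ R ω n t).IsChain brickWallGraph.Adj := by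
  unfold block
  split_ifs with h1 h2 h3
  · obtain ⟨hg, -⟩ := crossing_geometry (x₀ := x₀) hW ht h1.1 h1.2
    rw [List.isChain_cons]
    refine ⟨fun y hy => ?_, isChain_zig (parity_of_admissible hW ht.le (hRad _ h1.2))⟩
    rw [head?_zig, Option.mem_def, Option.some.injEq] at hy
    subst hy
    unfold smap; rw [adj_mk_iff]; left
    refine ⟨?_, rfl⟩
    omega
  · obtain ⟨hg, -⟩ := crossing_geometry (x₀ := x₀) hW ht h1.1 h1.2
    rw [List.isChain_cons]
    refine ⟨fun y hy => ?_, isChain_reverse_zig (parity_of_admissible hW ht.le (hRad _ h1.2))⟩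
    rw [head?_reverse_zig, Option.mem_def, Option.some.injEq] at hy
    subst hy
    unfold smap; rw [adj_mk_iff]; left
    refine ⟨?_, rfl⟩
    omega
  · obtain ⟨hg, -⟩ := crossing_geometry (x₀ := x₀) hW ht h1.1 h1.2
    have hd : ω (t + 1) 0 - ω t 0 = 1 ∨ ω (t + 1) 0 - ω t 0 = -1 := by
      rcases hg with ⟨g, -⟩ | ⟨g, -⟩
      · exact Or.inl g
      · exact Or.inr g
    refine List.isChain_cons_cons.2 ⟨?_, List.isChain_cons_cons.2 ⟨?_, List.isChain_cons_cons.2 ⟨?_,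
      List.isChain_cons_cons.2 ⟨?_, List.isChain_singleton _⟩⟩⟩⟩
    all_goals
      first | (unfold smap; rw [adj_mk_iff]; left) | (rw [adj_mk_iff]; left)
      refine ⟨?_, rfl⟩
      omega
  · exact List.isChain_singleton _

/-- The last point of the block of step `t` is adjacent to the next anchor. [cite: MadrasSlade1993, Theorem 8.2.1 (8.2.13), p. 269 (statement; the insertion here is the lane's proof, not the printed one)] -/
theorem getLast_block_adj (hW : StripWalk T ω n) {t : ℕ} (ht : t < n) :
    ∀ z ∈ (block T x₀ R ω n t).getLast?, brickWallGraph.Adj z (smap x₀ R (ω (t + 1))) := by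
  intro z hz
  unfold block at hz
  split_ifs at hz with h1 h2 h3
  · obtain ⟨hg, h5⟩ := crossing_geometry (x₀ := x₀) hW ht h1.1 h1.2
    rw [List.getLast?_cons, getLast?_zig] at hz
    simp only [Option.getD_some, Option.mem_def, Option.some.injEq] at hz
    subst hz
    unfold smap
    rw [adj_mk_iff, h5, ← hW.row_eq ht h1.1]; left
    refine ⟨?_, rfl⟩
    omega
  · obtain ⟨hg, h5⟩ := crossing_geometry (x₀ := x₀) hW ht h1.1 h1.2
    rw [List.getLast?_cons, getLast?_reverse_zig] at hz
    simp only [Option.getD_some, Option.mem_def, Option.some.injEq] at hz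
    subst hz
    unfold smap
    rw [adj_mk_iff, h5, ← hW.row_eq ht h1.1]; left
    refine ⟨?_, rfl⟩
    omega
  · obtain ⟨hg, h5⟩ := crossing_geometry (x₀ := x₀) hW ht h1.1 h1.2
    have hd : ω (t + 1) 0 - ω t 0 = 1 ∨ ω (t + 1) 0 - ω t 0 = -1 := by
      rcases hg with ⟨g, -⟩ | ⟨g, -⟩
      · exact Or.inl g
      · exact Or.inr g
    simp only [List.getLast?_cons_cons, List.getLast?_singleton, Option.mem_def,
      Option.some.injEq] at hz
    subst hz
    unfold smap
    rw [adj_mk_iff, h5, ← hW.row_eq ht h1.1]; left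
    refine ⟨?_, rfl⟩
    omega
  · simp only [List.getLast?_singleton, Option.mem_def, Option.some.injEq] at hz
    subst hz
    refine adj_smap_of_adj (hW.adj t ht) fun hne => ?_
    exact fun hR => h1 ⟨hne, hR⟩

/-- Gluing the blocks: the concatenation of the blocks `0 … m-1` (`m ≤ n`) is a chain whose last point is
adjacent to the anchor `σ(ω m)`. [cite: MadrasSlade1993, Theorem 8.2.1 (8.2.13), p. 269 (statement; the insertion here is the lane's proof, not the printed one)] -/
theorem isChain_flatMap_blocks (hW : StripWalk T ω n) (hRad : ∀ c ∈ R, (c + (T : ℤ)) % 2 = 1) :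
    ∀ m ≤ n, ((List.range m).flatMap (block T x₀ R ω n)).IsChain brickWallGraph.Adj ∧
      ∀ z ∈ ((List.range m).flatMap (block T x₀ R ω n)).getLast?, brickWallGraph.Adj z (smap x₀ R (ω m))
  | 0, _ => by simp
  | m + 1, hm => by
    obtain ⟨ih1, ih2⟩ := isChain_flatMap_blocks hW hRad m (by omega)
    rw [List.range_succ, List.flatMap_append, List.flatMap_singleton]
    refine ⟨List.IsChain.append ih1 (isChain_block hW hRad (by omega)) fun z hz y hy => ?_, ?_⟩
    · rw [head?_block, Option.mem_def, Option.some.injEq] at hy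
      subst hy
      exact ih2 z hz
    · intro z hz
      rw [List.getLast?_append] at hz
      obtain ⟨w, hw⟩ := List.getLast?_isSome.2 (block_ne_nil T x₀ R ω n m) |> Option.isSome_iff_exists.1
      rw [hw, Option.some_or, Option.mem_def, Option.some.injEq] at hz
      subst hz
      exact getLast_block_adj hW (by omega) w (by rw [hw]; rfl)

/-- **The image list is a brick-wall chain.** [cite: MadrasSlade1993, Theorem 8.2.1 (8.2.13), p. 269 (statement; the insertion here is the lane's proof, not the printed one)] -/
theorem isChain_imageList (hW : StripWalk T ω n) (hRad : ∀ c ∈ R, (c + (T : ℤ)) % 2 = 1) :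
    (imageList T x₀ R ω n).IsChain brickWallGraph.Adj := by
  obtain ⟨h1, h2⟩ := isChain_flatMap_blocks (x₀ := x₀) hW hRad n le_rfl
  exact List.IsChain.append h1 (List.isChain_singleton _) fun z hz y hy => by
    rw [List.head?_cons, Option.mem_def, Option.some.injEq] at hy
    subst hy; exact h2 z hz

/-- The image list starts at the anchor `σ(ω 0)`. [cite: MadrasSlade1993, Theorem 8.2.1 (8.2.13), p. 269 (statement; the insertion here is the lane's proof, not the printed one)] -/
theorem head?_imageList (T : ℕ) (x₀ : ℤ) (R : Finset ℤ) (ω : ℕ → Site 2) (n : ℕ) :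
    (imageList T x₀ R ω n).head? = some (smap x₀ R (ω 0)) := by
  unfold imageList
  cases n with
  | zero => simp
  | succ n =>
    rw [List.range_succ_eq_map, List.flatMap_cons, List.append_assoc, List.head?_append,
      head?_block, Option.some_or]

/-- All points of the image list lie in the rows `0 … T+1`. [cite: MadrasSlade1993, Theorem 8.2.1 (8.2.13), p. 269 (statement; the insertion here is the lane's proof, not the printed one)] -/
theorem row_mem_imageList (hW : StripWalk T ω n) {z : Site 2} (hz : z ∈ imageList T x₀ R ω n) :
    0 ≤ z 1 ∧ z 1 ≤ (T : ℤ) + 1 := by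
  rw [imageList, List.mem_append, List.mem_flatMap, List.mem_singleton] at hz
  rcases hz with ⟨t, ht, hzt⟩ | rfl
  · exact row_mem_block hW (List.mem_range.1 ht) hzt
  · exact ⟨by simpa using hW.row_nonneg n le_rfl, by simp; have := hW.row_le n le_rfl; omega⟩

/-! ### From vertex lists to the vertex functions of `Zd.saws` -/

/-- The vertex function of a vertex list, frozen at the last vertex. [cite: MadrasSlade1993, Theorem 8.2.1 (8.2.13), p. 269 (statement; the insertion here is the lane's proof, not the printed one)] -/
def ofList (l : List (Site 2)) (s : ℕ) : Site 2 := (l[s]?).getD (l.getLast?.getD 0)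

/-- `ofList l s = l[s]` inside the list. [cite: MadrasSlade1993, Theorem 8.2.1 (8.2.13), p. 269 (statement; the insertion here is the lane's proof, not the printed one)] -/
theorem ofList_eq_getElem {l : List (Site 2)} {s : ℕ} (hs : s < l.length) : ofList l s = l[s] := by
  simp [ofList, List.getElem?_eq_getElem hs]

/-- `ofList l s` is the last vertex from the last index on. [cite: MadrasSlade1993, Theorem 8.2.1 (8.2.13), p. 269 (statement; the insertion here is the lane's proof, not the printed one)] -/
theorem ofList_eq_getLast {l : List (Site 2)} (hl : l ≠ []) {s : ℕ} (hs : l.length - 1 ≤ s) :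
    ofList l s = l.getLast hl := by
  rcases lt_or_ge s l.length with h | h
  · rw [ofList_eq_getElem h, List.getLast_eq_getElem]
    congr 1; omega
  · simp [ofList, List.getElem?_eq_none h, List.getLast?_eq_getLast_of_ne_nil hl]

/-- `ofList l s` is a member of `l`. [cite: MadrasSlade1993, Theorem 8.2.1 (8.2.13), p. 269 (statement; the insertion here is the lane's proof, not the printed one)] -/
theorem ofList_mem {l : List (Site 2)} (hl : l ≠ []) (s : ℕ) : ofList l s ∈ l := by
  rcases lt_or_ge s l.length with h | h
  · rw [ofList_eq_getElem h]; exact List.getElem_mem h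
  · rw [ofList_eq_getLast hl (by omega)]; exact List.getLast_mem _

/-- A duplicate-free brick-wall vertex list, read as a vertex function translated to the origin, is a walk of
`Zd.saws`, and its steps are brick-wall bonds. [cite: MadrasSlade1993, Theorem 8.2.1 (8.2.13), p. 269 (statement; the insertion here is the lane's proof, not the printed one)] -/
theorem ofList_sub_mem_saws {l : List (Site 2)} (hl : l ≠ []) (hN : l.Nodup)
    (hC : l.IsChain brickWallGraph.Adj) (p : Site 2) (hp : l.head? = some p) :
    (fun s => ofList l s - p) ∈ Zd.saws 2 (l.length - 1) ∧ IsBW (l.length - 1) (ofList l) := by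
  have hlen : 0 < l.length := List.length_pos_of_ne_nil hl
  have hp' : l[0] = p := by
    rw [← List.head_eq_getElem hl]; exact Option.some.inj ((List.head?_eq_some_head hl).symm.trans hp)
  have hbw : IsBW (l.length - 1) (ofList l) := fun i hi => by
    rw [ofList_eq_getElem (by omega), ofList_eq_getElem (by omega)]
    exact List.isChain_iff_getElem.1 hC i (by omega)
  refine ⟨Zd.mem_saws.2 ⟨?_, ?_, ?_, ?_⟩, hbw⟩
  · show ofList l 0 - p = 0
    rw [ofList_eq_getElem hlen, hp', sub_self]
  · intro i hi
    show ofList l i - p = ofList l (l.length - 1) - p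
    rw [ofList_eq_getLast hl hi, ofList_eq_getLast hl le_rfl]
  · intro i hi
    show (zdGraph 2).Adj (ofList l i - p) (ofList l (i + 1) - p)
    rw [Zd.zdGraph_adj_sub_right]
    exact zd_adj_of_adj (hbw i hi)
  · intro i hi j hj hij
    simp only [Set.mem_setOf_eq] at hi hj
    have h' : ofList l i = ofList l j := sub_left_inj.1 hij
    rw [ofList_eq_getElem (by omega), ofList_eq_getElem (by omega)] at h'
    exact (hN.getElem_inj_iff).1 h'

/-- Two lists of the same length with the same vertex function are equal. [cite: MadrasSlade1993, Theorem 8.2.1 (8.2.13), p. 269 (statement; the insertion here is the lane's proof, not the printed one)] -/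
theorem ofList_inj {l l' : List (Site 2)} (hlen : l.length = l'.length)
    (h : ∀ s, ofList l s = ofList l' s) : l = l' :=
  List.ext_getElem hlen fun i h1 h2 => by
    rw [← ofList_eq_getElem h1, ← ofList_eq_getElem h2, h i]

/-- A vertex function belongs to at most one `Zd.saws d m`. [cite: MadrasSlade1993, Theorem 8.2.1 (8.2.13), p. 269 (statement; the insertion here is the lane's proof, not the printed one)] -/
theorem eq_of_mem_saws_of_mem_saws {d m m' : ℕ} {υ : ℕ → Site d} (h : υ ∈ Zd.saws d m)
    (h' : υ ∈ Zd.saws d m') : m = m' := by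
  obtain ⟨-, he, -, hi⟩ := Zd.mem_saws.1 h
  obtain ⟨-, he', -, hi'⟩ := Zd.mem_saws.1 h'
  by_contra hne
  rcases lt_or_gt_of_ne hne with hlt | hlt
  · have := hi' (show m ≤ m' by omega) (show m + 1 ≤ m' by omega) (he (m + 1) (by omega)).symm
    omega
  · have := hi (show m' ≤ m by omega) (show m' + 1 ≤ m by omega) (he' (m' + 1) (by omega)).symm
    omega

/-! ### The image walk `Ψ(ω, R)` -/

/-- `Ψ(ω,R)` as a vertex function from the origin (base column = the column of `ω 0`). [cite: MadrasSlade1993, Theorem 8.2.1 (8.2.13), p. 269 (statement; the insertion here is the lane's proof, not the printed one)] -/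
def psi (T : ℕ) (R : Finset ℤ) (ω : ℕ → Site 2) (n : ℕ) : ℕ → Site 2 :=
  fun s => ofList (imageList T (ω 0 0) R ω n) s - ω 0

/-- The image list is non-empty. [cite: MadrasSlade1993, Theorem 8.2.1 (8.2.13), p. 269 (statement; the insertion here is the lane's proof, not the printed one)] -/
theorem imageList_ne_nil (T : ℕ) (x₀ : ℤ) (R : Finset ℤ) (ω : ℕ → Site 2) (n : ℕ) :
    imageList T x₀ R ω n ≠ [] := by
  simp [imageList]

/-- **`Ψ(ω,R)` is a self-avoiding walk** of length `|imageList| - 1` from the origin, whose translate by `ω 0`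
is a brick-wall walk in the strip of height `T + 1`. [cite: MadrasSlade1993, Theorem 8.2.1 (8.2.13), p. 269 (statement; the insertion here is the lane's proof, not the printed one)] -/
theorem psi_spec (hW : StripWalk T ω n) (hRad : ∀ c ∈ R, (c + (T : ℤ)) % 2 = 1) :
    psi T R ω n ∈ Zd.saws 2 ((imageList T (ω 0 0) R ω n).length - 1) ∧
      IsBW ((imageList T (ω 0 0) R ω n).length - 1) (fun i => ω 0 + psi T R ω n i) ∧
      ∀ m ≤ (imageList T (ω 0 0) R ω n).length - 1, InStrip (T + 1) (ω 0 + psi T R ω n m) := by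
  have h := ofList_sub_mem_saws (imageList_ne_nil T (ω 0 0) R ω n) (nodup_imageList hW R)
    (isChain_imageList hW hRad) (ω 0) (by rw [head?_imageList, smap_eq_self_of_col R rfl])
  refine ⟨h.1, ?_, fun m _ => ?_⟩
  · have e : (fun i => ω 0 + psi T R ω n i) = ofList (imageList T (ω 0 0) R ω n) := by
      funext i; simp [psi]
    rw [e]; exact h.2
  · have e : ω 0 + psi T R ω n m = ofList (imageList T (ω 0 0) R ω n) m := by simp [psi]
    rw [e]
    have := row_mem_imageList hW (ofList_mem (imageList_ne_nil T (ω 0 0) R ω n) m)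
    exact ⟨this.1, by push_cast; exact this.2⟩

/-! ### Length of the image and the cost of a cut -/

/-- The length of a block: `1 +` the extra length of a crossing of a cut of `R`. [cite: MadrasSlade1993, Theorem 8.2.1 (8.2.13), p. 269 (statement; the insertion here is the lane's proof, not the printed one)] -/
theorem length_block (T : ℕ) (x₀ : ℤ) (R : Finset ℤ) (ω : ℕ → Site 2) (n t : ℕ) :
    (block T x₀ R ω n t).length =
      1 + if ω t 0 ≠ ω (t + 1) 0 ∧ cutOf ω t ∈ R then extra T ω n (cutOf ω t) t else 0 := by
  unfold block extra
  split_ifs <;> simp [length_zig] <;> omega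

/-- The crossing times of `c` are the horizontal steps whose cut is `c`. [cite: MadrasSlade1993, Theorem 8.2.1 (8.2.13), p. 269 (statement; the insertion here is the lane's proof, not the printed one)] -/
theorem crossTimes_eq_filter (hW : StripWalk T ω n) (c : ℤ) :
    crossTimes ω n c = (Finset.range n).filter fun t => ω t 0 ≠ ω (t + 1) 0 ∧ cutOf ω t = c := by
  ext t
  rw [mem_crossTimes, Finset.mem_filter, Finset.mem_range]
  constructor
  · rintro ⟨ht, hc⟩
    exact ⟨ht, hc.ne, hc.cutOf_eq⟩
  · rintro ⟨ht, hne, rfl⟩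
    exact ⟨ht, (crosses_cutOf_of_ne (hW.adj t ht) hne).1⟩

/-- A list sum over `range` is a `Finset` sum. [cite: MadrasSlade1993, Theorem 8.2.1 (8.2.13), p. 269 (statement; the insertion here is the lane's proof, not the printed one)] -/
theorem list_sum_map_range {M : Type*} [AddCommMonoid M] (f : ℕ → M) :
    ∀ n : ℕ, ((List.range n).map f).sum = ∑ t ∈ Finset.range n, f t
  | 0 => by simp
  | n + 1 => by
    rw [List.range_succ, List.map_append, List.sum_append, list_sum_map_range f n,
      Finset.sum_range_succ]
    simp

/-- **Length of the image**: `|Ψ(ω,R)| = n + Σ_{c ∈ R} cost(c)` steps. [cite: MadrasSlade1993, Theorem 8.2.1 (8.2.13), p. 269 (statement; the insertion here is the lane's proof, not the printed one)] -/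
theorem length_imageList (hW : StripWalk T ω n) (R : Finset ℤ) :
    (imageList T x₀ R ω n).length = n + 1 + ∑ c ∈ R, cost T ω n c := by
  rw [imageList, List.length_append, List.length_singleton, List.length_flatMap,
    list_sum_map_range]
  simp_rw [length_block]
  rw [Finset.sum_add_distrib, Finset.sum_const, Finset.card_range, smul_eq_mul, mul_one,
    ← Finset.sum_filter]
  have hmaps : ∀ t ∈ (Finset.range n).filter (fun t => ω t 0 ≠ ω (t + 1) 0 ∧ cutOf ω t ∈ R),
      cutOf ω t ∈ R := fun t ht => (Finset.mem_filter.1 ht).2.2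
  rw [← Finset.sum_fiberwise_of_maps_to hmaps]
  have hinner : ∀ c ∈ R,
      ∑ t ∈ ((Finset.range n).filter (fun t => ω t 0 ≠ ω (t + 1) 0 ∧ cutOf ω t ∈ R)).filter
          (fun t => cutOf ω t = c), extra T ω n (cutOf ω t) t = cost T ω n c := by
    intro c hc
    rw [cost, crossTimes_eq_filter hW c]
    refine Finset.sum_congr ?_ fun t ht => ?_
    · ext t
      simp only [Finset.mem_filter, Finset.mem_range]
      constructor
      · rintro ⟨⟨ht, hne, -⟩, rfl⟩; exact ⟨ht, hne, rfl⟩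
      · rintro ⟨ht, hne, rfl⟩; exact ⟨⟨ht, hne, hc⟩, rfl⟩
    · rw [(Finset.mem_filter.1 ht).2.2]
  rw [Finset.sum_congr rfl hinner]
  ring

/-- The number of crossings of a cut is at most `(top row) + 1`: distinct strands have distinct rows in
`{0, …, top}`. [cite: MadrasSlade1993, Theorem 8.2.1 (8.2.13), p. 269 (statement; the insertion here is the lane's proof, not the printed one)] -/
theorem card_crossTimes_le (hW : StripWalk T ω n) {c : ℤ} {s : ℕ} (hs : s ∈ crossTimes ω n c)
    (htop : IsTop ω n c s) : (crossTimes ω n c).card ≤ (ω s 1).toNat + 1 := by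
  have h := Finset.card_le_card_of_injOn (s := crossTimes ω n c) (t := Finset.range ((ω s 1).toNat + 1))
    (fun t => (ω t 1).toNat) (fun t ht => ?_) (fun t ht t' ht' h => ?_)
  · simpa using h
  · have h1 := htop t ht
    have h0 := hW.row_nonneg t (mem_crossTimes.1 ht).1.le
    have h0' := hW.row_nonneg s (mem_crossTimes.1 hs).1.le
    simp only [Finset.coe_range, Set.mem_Iio]
    omega
  · have h0 := hW.row_nonneg t (mem_crossTimes.1 ht).1.le
    have h0' := hW.row_nonneg t' (mem_crossTimes.1 ht').1.le
    exact crossTimes_row_inj hW.inj hW.rows ht ht' (by simp only at h; omega)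

/-- **Cost bound**: each cut costs at most `4T + 6` extra steps (`4` per lower strand, `4(T − z) + 6` for the
top strand at row `z`, and at most `z` lower strands). [cite: MadrasSlade1993, Theorem 8.2.1 (8.2.13), p. 269 (statement; the insertion here is the lane's proof, not the printed one)] -/
theorem cost_le (hW : StripWalk T ω n) {c : ℤ} (hc : c ∈ cutsP ω n) : cost T ω n c ≤ 4 * T + 6 := by
  obtain ⟨s, hs, htop⟩ := exists_isTop hW.adj hc
  have huniq : ∀ t ∈ crossTimes ω n c, t ≠ s → ¬ IsTop ω n c t := by
    intro t ht hts h
    exact hts (crossTimes_row_inj hW.inj hW.rows ht hs (le_antisymm (htop t ht) (h s hs)))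
  rw [cost, ← Finset.add_sum_erase _ _ hs]
  have h2 : ∑ t ∈ (crossTimes ω n c).erase s, extra T ω n c t = 4 * ((crossTimes ω n c).card - 1) := by
    rw [Finset.sum_congr rfl fun t ht => ?_, Finset.sum_const, Finset.card_erase_of_mem hs,
      smul_eq_mul, mul_comm]
    rw [extra, if_neg (huniq t (Finset.mem_of_mem_erase ht) (Finset.ne_of_mem_erase ht))]
  rw [h2, extra, if_pos htop]
  have hk := card_crossTimes_le hW hs htop
  have hL := hW.row_le s (mem_crossTimes.1 hs).1.le
  have h0 := hW.row_nonneg s (mem_crossTimes.1 hs).1.le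
  have : (ω s 1).toNat ≤ T := by omega
  have hpos : 1 ≤ (crossTimes ω n c).card := Finset.card_pos.2 ⟨s, hs⟩
  omega

/-- There are at most `n` cuts. [cite: MadrasSlade1993, Theorem 8.2.1 (8.2.13), p. 269 (statement; the insertion here is the lane's proof, not the printed one)] -/
theorem card_cutsP_le (ω : ℕ → Site 2) (n : ℕ) : (cutsP ω n).card ≤ n := by
  unfold cutsP
  exact Finset.card_image_le.trans ((Finset.card_filter_le _ _).trans (by simp))


/-! ### Injectivity: recovering `ω` from the image (given `R`) -/

section Good

open Classical in
/-- The Boolean test "the column of `z` is in the range of `σ`". [cite: MadrasSlade1993, Theorem 8.2.1 (8.2.13), p. 269 (statement; the insertion here is the lane's proof, not the printed one)] -/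
def isGood (x₀ : ℤ) (R : Finset ℤ) (z : Site 2) : Bool := decide (∃ x, z 0 = colMap x₀ R x)

open Classical in
/-- Anchors pass the test `isGood`. [cite: MadrasSlade1993, Theorem 8.2.1 (8.2.13), p. 269 (statement; the insertion here is the lane's proof, not the printed one)] -/
theorem isGood_smap (x₀ : ℤ) (R : Finset ℤ) (p : Site 2) : isGood x₀ R (smap x₀ R p) = true := by
  unfold isGood; exact decide_eq_true ⟨p 0, rfl⟩

open Classical in
/-- Inserted points fail the test `isGood`. [cite: MadrasSlade1993, Theorem 8.2.1 (8.2.13), p. 269 (statement; the insertion here is the lane's proof, not the printed one)] -/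
theorem isGood_eq_false {c : ℤ} (hc : c ∈ R) {z : Site 2}
    (hz : colMap x₀ R c + 1 ≤ z 0 ∧ z 0 ≤ colMap x₀ R c + 4) : isGood x₀ R z = false := by
  unfold isGood
  rw [decide_eq_false_iff_not]
  rintro ⟨x, hx⟩
  rw [hx] at hz
  exact colMap_not_ins hc x hz

/-- Filtering a block to the columns in the range of `σ` leaves its anchor. [cite: MadrasSlade1993, Theorem 8.2.1 (8.2.13), p. 269 (statement; the insertion here is the lane's proof, not the printed one)] -/
theorem filter_good_block (hW : StripWalk T ω n) {t : ℕ} (ht : t < n) :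
    (block T x₀ R ω n t).filter (isGood x₀ R) = [smap x₀ R (ω t)] := by
  have hcons : ∃ rest, block T x₀ R ω n t = smap x₀ R (ω t) :: rest := by
    unfold block; split_ifs <;> exact ⟨_, rfl⟩
  obtain ⟨rest, hrest⟩ := hcons
  have hbad : ∀ z ∈ rest, ¬ isGood x₀ R z = true := by
    intro z hz
    have hz' : z ∈ block T x₀ R ω n t := by rw [hrest]; exact List.mem_cons_of_mem _ hz
    have hnd := nodup_block (x₀ := x₀) (R := R) hW ht
    rw [hrest, List.nodup_cons] at hnd
    rcases mem_block hW ht hz' with h | ⟨-, hRc, hcol, -⟩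
    · exact absurd (h ▸ hz) hnd.1
    · rw [isGood_eq_false hRc hcol]; exact Bool.false_ne_true
  rw [hrest, List.filter_cons_of_pos (isGood_smap x₀ R (ω t)), List.filter_eq_nil_iff.2 hbad]

/-- **Recovering `ω`**: the image points in the columns of `σ(ℤ)` are exactly the anchors
`σ(ω 0), …, σ(ω n)`, in order. [cite: MadrasSlade1993, Theorem 8.2.1 (8.2.13), p. 269 (statement; the insertion here is the lane's proof, not the printed one)] -/
theorem filter_good_imageList (hW : StripWalk T ω n) :
    (imageList T x₀ R ω n).filter (isGood x₀ R) = (List.range (n + 1)).map fun t => smap x₀ R (ω t) := by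
  rw [imageList, List.filter_append, List.filter_flatMap,
    List.flatMap_congr fun t ht => filter_good_block hW (List.mem_range.1 ht),
    ← List.map_eq_flatMap, List.filter_cons_of_pos (isGood_smap x₀ R (ω n)),
    List.filter_nil, List.range_succ, List.map_append, List.map_singleton]

end Good

/-! ### Injectivity: recovering `R` from the image -/

/-- The TALL inserted columns of `R`: `σ c + 1, σ c + 2, σ c + 3` for `c ∈ R` (the columns of an inserted block
that meet the top row `T + 1`). [cite: MadrasSlade1993, Theorem 8.2.1 (8.2.13), p. 269 (statement; the insertion here is the lane's proof, not the printed one)] -/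
def insCols (x₀ : ℤ) (R : Finset ℤ) : Finset ℤ :=
  R.biUnion fun c => {colMap x₀ R c + 1, colMap x₀ R c + 2, colMap x₀ R c + 3}

/-- Membership in `insCols`. [cite: MadrasSlade1993, Theorem 8.2.1 (8.2.13), p. 269 (statement; the insertion here is the lane's proof, not the printed one)] -/
theorem mem_insCols {y : ℤ} :
    y ∈ insCols x₀ R ↔ ∃ c ∈ R, y = colMap x₀ R c + 1 ∨ y = colMap x₀ R c + 2 ∨ y = colMap x₀ R c + 3 := by
  simp [insCols]

/-- No column of `σ(ℤ)` is a tall inserted column. [cite: MadrasSlade1993, Theorem 8.2.1 (8.2.13), p. 269 (statement; the insertion here is the lane's proof, not the printed one)] -/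
theorem colMap_not_mem_insCols (x₀ : ℤ) (R : Finset ℤ) (x : ℤ) : colMap x₀ R x ∉ insCols x₀ R := by
  rw [mem_insCols]
  rintro ⟨c, hc, h⟩
  exact colMap_not_ins (x₀ := x₀) hc x (by omega)

/-- `σ x − 1` is never a tall inserted column either (it would be `σ c + 2 … σ c + 4`). [cite: MadrasSlade1993, Theorem 8.2.1 (8.2.13), p. 269 (statement; the insertion here is the lane's proof, not the printed one)] -/
theorem colMap_pred_not_mem_insCols (x₀ : ℤ) (R : Finset ℤ) (x : ℤ) : colMap x₀ R x - 1 ∉ insCols x₀ R := by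
  rw [mem_insCols]
  rintro ⟨c, hc, h⟩
  exact colMap_not_ins (x₀ := x₀) hc x (by omega)

/-- `x ∈ R` iff the column after `σ x` is a tall inserted column. [cite: MadrasSlade1993, Theorem 8.2.1 (8.2.13), p. 269 (statement; the insertion here is the lane's proof, not the printed one)] -/
theorem mem_iff_succ_mem_insCols (x : ℤ) : x ∈ R ↔ colMap x₀ R x + 1 ∈ insCols x₀ R := by
  constructor
  · intro hx; exact mem_insCols.2 ⟨x, hx, Or.inl rfl⟩
  · intro h
    by_contra hx
    rw [← colMap_succ_of_not_mem hx] at h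
    exact colMap_not_mem_insCols x₀ R _ h

/-- `x ∈ R` iff the column two before `σ(x+1)` is a tall inserted column. [cite: MadrasSlade1993, Theorem 8.2.1 (8.2.13), p. 269 (statement; the insertion here is the lane's proof, not the printed one)] -/
theorem mem_iff_pred_mem_insCols (x : ℤ) : x ∈ R ↔ colMap x₀ R (x + 1) - 2 ∈ insCols x₀ R := by
  constructor
  · intro hx
    rw [colMap_succ_of_mem hx]
    exact mem_insCols.2 ⟨x, hx, Or.inr (Or.inr (by ring))⟩
  · intro h
    by_contra hx
    rw [colMap_succ_of_not_mem hx, show colMap x₀ R x + 1 - 2 = colMap x₀ R x - 1 by ring] at h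
    exact colMap_pred_not_mem_insCols x₀ R _ h

/-- `σ` is determined by its set of tall inserted columns (induction up and down from the base column).
[cite: MadrasSlade1993, Theorem 8.2.1 (8.2.13), p. 269 (statement; the insertion here is the lane's proof, not the printed one)] -/
theorem colMap_eq_of_insCols_eq {R' : Finset ℤ} (h : insCols x₀ R = insCols x₀ R') (x : ℤ) :
    colMap x₀ R x = colMap x₀ R' x := by
  induction x using Int.inductionOn' with
  | b => exact x₀
  | zero => rw [colMap_base, colMap_base]
  | succ k _ ih =>
    have hm : k ∈ R ↔ k ∈ R' := by
      rw [mem_iff_succ_mem_insCols (x₀ := x₀) (R := R), mem_iff_succ_mem_insCols (x₀ := x₀) (R := R'), ih, h]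
    rw [colMap_succ, colMap_succ, ih]
    by_cases hk : k ∈ R
    · rw [if_pos hk, if_pos (hm.1 hk)]
    · rw [if_neg hk, if_neg (fun h' => hk (hm.2 h'))]
  | pred k _ ih =>
    have e1 := colMap_succ x₀ R (k - 1)
    have e2 := colMap_succ x₀ R' (k - 1)
    rw [sub_add_cancel] at e1 e2
    have hm : (k - 1) ∈ R ↔ (k - 1) ∈ R' := by
      rw [mem_iff_pred_mem_insCols (x₀ := x₀) (R := R), mem_iff_pred_mem_insCols (x₀ := x₀) (R := R'),
        sub_add_cancel, ih, h]
    by_cases hk : (k - 1) ∈ R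
    · rw [if_pos hk] at e1; rw [if_pos (hm.1 hk)] at e2; omega
    · rw [if_neg hk] at e1; rw [if_neg (fun h' => hk (hm.2 h'))] at e2; omega

/-- **Recovering `R`**: the set of tall inserted columns determines `R`. [cite: MadrasSlade1993, Theorem 8.2.1 (8.2.13), p. 269 (statement; the insertion here is the lane's proof, not the printed one)] -/
theorem insCols_injective {R' : Finset ℤ} (h : insCols x₀ R = insCols x₀ R') : R = R' := by
  ext x
  rw [mem_iff_succ_mem_insCols (x₀ := x₀) (R := R) x, mem_iff_succ_mem_insCols (x₀ := x₀) (R := R') x,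
    colMap_eq_of_insCols_eq h x, h]

/-- The columns of the points of a list in the top row `T + 1`. [cite: MadrasSlade1993, Theorem 8.2.1 (8.2.13), p. 269 (statement; the insertion here is the lane's proof, not the printed one)] -/
def tallCols (T : ℕ) (l : List (Site 2)) : Finset ℤ :=
  (l.toFinset.filter fun z => z 1 = (T : ℤ) + 1).image fun z => z 0

/-- Membership in `tallCols`. [cite: MadrasSlade1993, Theorem 8.2.1 (8.2.13), p. 269 (statement; the insertion here is the lane's proof, not the printed one)] -/
theorem mem_tallCols {l : List (Site 2)} {y : ℤ} :
    y ∈ tallCols T l ↔ ∃ z ∈ l, z 1 = (T : ℤ) + 1 ∧ z 0 = y := by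
  simp [tallCols, and_assoc]

/-- **The tall columns of the image are exactly the tall inserted columns** (for `R ⊆ cuts`). [cite: MadrasSlade1993, Theorem 8.2.1 (8.2.13), p. 269 (statement; the insertion here is the lane's proof, not the printed one)] -/
theorem tallCols_imageList (hW : StripWalk T ω n) (hR : R ⊆ cutsP ω n) :
    tallCols T (imageList T x₀ R ω n) = insCols x₀ R := by
  ext y
  rw [mem_tallCols, mem_insCols]
  constructor
  · rintro ⟨z, hz, hz1, rfl⟩
    rw [imageList, List.mem_append, List.mem_flatMap, List.mem_singleton] at hz
    rcases hz with ⟨t, ht, hzt⟩ | rfl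
    · rcases mem_block hW (List.mem_range.1 ht) hzt with rfl | ⟨-, hRc, hcol, -, -, -, htop⟩
      · have := hW.row_le t (List.mem_range.1 ht).le
        simp at hz1; omega
      · have := htop hz1
        exact ⟨_, hRc, by omega⟩
    · have := hW.row_le n le_rfl
      simp at hz1; omega
  · rintro ⟨c, hc, hy⟩
    obtain ⟨s, hs, htop⟩ := exists_isTop hW.adj (hR hc)
    obtain ⟨hsn, hsc⟩ := mem_crossTimes.1 hs
    have hne := hsc.ne
    have hcut := hsc.cutOf_eq
    have e := hW.row_add hsn.le
    -- the block of the top crossing contains the three top points of the excursion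
    have hzig : ∀ z ∈ zig (colMap x₀ R c) (ω s 1) (T - (ω s 1).toNat), z ∈ block T x₀ R ω n s := by
      intro z hz
      unfold block
      rw [if_pos ⟨hne, hcut.symm ▸ hc⟩, hcut, if_pos htop]
      refine List.mem_cons_of_mem _ ?_
      split_ifs
      · exact hz
      · exact List.mem_reverse.2 hz
    have hmem : ∀ z ∈ block T x₀ R ω n s, z ∈ imageList T x₀ R ω n := fun z hz => by
      rw [imageList, List.mem_append, List.mem_flatMap]
      exact Or.inl ⟨s, List.mem_range.2 hsn, hz⟩
    obtain ⟨j, hj1, hj3, hyj⟩ : ∃ j : ℕ, 1 ≤ j ∧ j ≤ 3 ∧ y = colMap x₀ R c + (j : ℤ) := by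
      rcases hy with h | h | h
      · exact ⟨1, le_rfl, by norm_num, by simpa using h⟩
      · exact ⟨2, by norm_num, by norm_num, by simpa using h⟩
      · exact ⟨3, by norm_num, le_rfl, by simpa using h⟩
    refine ⟨mk (colMap x₀ R c + (j : ℤ)) (ω s 1 + ((T - (ω s 1).toNat : ℕ) : ℤ) + 1),
      hmem _ (hzig _ (top_mem_zig _ _ _ hj1 hj3)), ?_, ?_⟩
    · simp only [mk_one]; omega
    · simp only [mk_zero]; exact hyj.symm

/-- **Injectivity of `(ω, R) ↦ Ψ(ω, R)`** on strip walks with `R ⊆ cuts(ω)` (list form). [cite: MadrasSlade1993, Theorem 8.2.1 (8.2.13), p. 269 (statement; the insertion here is the lane's proof, not the printed one)] -/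
theorem imageList_inj {ω' : ℕ → Site 2} {R' : Finset ℤ} (hW : StripWalk T ω n)
    (hW' : StripWalk T ω' n) (hR : R ⊆ cutsP ω n) (hR' : R' ⊆ cutsP ω' n)
    (h : imageList T x₀ R ω n = imageList T x₀ R' ω' n) : R = R' ∧ ∀ t ≤ n, ω t = ω' t := by
  classical
  have hRR : R = R' := by
    apply insCols_injective (x₀ := x₀)
    rw [← tallCols_imageList hW hR, ← tallCols_imageList hW' hR', h]
  subst hRR
  refine ⟨rfl, fun t ht => ?_⟩
  have hf := filter_good_imageList (x₀ := x₀) (R := R) hW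
  rw [h, filter_good_imageList hW'] at hf
  have := List.map_inj_left.1 hf.symm t (List.mem_range.2 (Nat.lt_succ_of_le ht))
  exact smap_injective x₀ R this

/-- **Injectivity of `Ψ`** (function form): equal images force `R = R'` and `ω = ω'` on `[0, n]`.
[cite: MadrasSlade1993, Theorem 8.2.1 (8.2.13), p. 269 (statement; the insertion here is the lane's proof, not the printed one)] -/
theorem psi_inj {ω' : ℕ → Site 2} {R' : Finset ℤ} (hW : StripWalk T ω n)
    (hW' : StripWalk T ω' n) (h0 : ω 0 = ω' 0) (hR : R ⊆ cutsP ω n) (hR' : R' ⊆ cutsP ω' n)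
    (hlen : (imageList T (ω 0 0) R ω n).length = (imageList T (ω' 0 0) R' ω' n).length)
    (h : psi T R ω n = psi T R' ω' n) : R = R' ∧ ∀ t ≤ n, ω t = ω' t := by
  rw [h0] at hlen
  refine imageList_inj (x₀ := ω' 0 0) hW hW' hR hR' (ofList_inj hlen fun s => ?_)
  have := congrFun h s
  simp only [psi, h0] at this
  exact sub_left_inj.1 this

/-! ### From `stripPairs` to strip walks -/

/-- The placed walk of a pair of `stripPairs T n` is a strip walk from its starting site. [cite: MadrasSlade1993, Theorem 8.2.1 (8.2.13), p. 269 (statement; the insertion here is the lane's proof, not the printed one)] -/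
theorem stripWalk_of_mem {p : Site 2 × (ℕ → Site 2)} (hp : p ∈ stripPairs T n) :
    StripWalk T (fun t => p.1 + p.2 t) n ∧ p.1 + p.2 0 = p.1 := by
  obtain ⟨-, hυ, hbw, hin⟩ := mem_stripPairs.1 hp
  obtain ⟨h0, -, -, hinj⟩ := Zd.mem_saws.1 hυ
  exact ⟨⟨hbw, fun t ht t' ht' h => hinj ht ht' (add_left_cancel h), fun t ht => (hin t ht).1,
    fun t ht => (hin t ht).2⟩, by simp [h0]⟩

/-- The tree's `HexBW.cuts a υ n` is `cutsP` of the placed walk. [cite: MadrasSlade1993, Theorem 8.2.1 (8.2.13), p. 269 (statement; the insertion here is the lane's proof, not the printed one)] -/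
theorem cutsP_eq (a : Site 2) (υ : ℕ → Site 2) (n : ℕ) : cutsP (fun t => a + υ t) n = cuts a υ n := rfl

end StripInsertion

/-! ### The insertion `Ψ` and its cost, over `stripPairs` / `admissibleCuts` (faces H1–H3 of the door) -/

section Insertion

open StripInsertion

variable {T n : ℕ}

/-- **The four-column insertion `Ψ`** of the door «HEX-STRIP-STRICT»: for a pair `p = (a, υ) ∈ stripPairs T n` and
a set `R` of parity-admissible cuts of the placed walk `t ↦ a + υ t`, the pair `(a, Ψ)` of the same start and the
translate of the image walk (four new columns after every cut of `R`, lower strands stretched, the top strand of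
each cut making the forced zigzag excursion to the new row `T + 1`).
[cite: MadrasSlade1993, Theorem 8.2.1 (8.2.13), p. 269 (statement; the insertion here is the lane's proof, not the printed one)] -/
def stripInsertion (T n : ℕ) (p : Site 2 × (ℕ → Site 2)) (R : Finset ℤ) : Site 2 × (ℕ → Site 2) :=
  (p.1, psi T R (fun t => p.1 + p.2 t) n)

/-- **The cost of a cut** under the insertion: the extra length of the image contributed by the strands crossing
the cut (`4` per lower strand, `4(T − z) + 6` for the top strand at row `z`).
[cite: MadrasSlade1993, Theorem 8.2.1 (8.2.13) (p. 269; proof by bridge renewal, p. 270 — ℤ^d tubes; not the proof formalised)] -/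
def stripInsertionCost (T n : ℕ) (p : Site 2 × (ℕ → Site 2)) (c : ℤ) : ℕ :=
  cost T (fun t => p.1 + p.2 t) n c

/-- The insertion keeps the starting site. [cite: MadrasSlade1993, Theorem 8.2.1 (8.2.13) (p. 269; proof by bridge renewal, p. 270 — ℤ^d tubes; not the proof formalised)] -/
@[simp] theorem stripInsertion_fst (T n : ℕ) (p : Site 2 × (ℕ → Site 2)) (R : Finset ℤ) :
    (stripInsertion T n p R).1 = p.1 := rfl

/-- **(H2, cost) Each admissible cut costs at most `4T + 6 ≤ 4T + 8` extra steps.**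
[cite: MadrasSlade1993, Theorem 8.2.1 (8.2.13) (p. 269; proof by bridge renewal, p. 270 — ℤ^d tubes; not the proof formalised)] -/
theorem stripInsertionCost_le_sharp {p : Site 2 × (ℕ → Site 2)} (hp : p ∈ stripPairs T n) {c : ℤ}
    (hc : c ∈ cuts p.1 p.2 n) : stripInsertionCost T n p c ≤ 4 * T + 6 :=
  cost_le (stripWalk_of_mem hp).1 (by rw [cutsP_eq]; exact hc)

/-- **(hcost) Each admissible cut costs at most `4T + 8` extra steps** (the binder of
`HexBW.core_of_insertion`). [cite: MadrasSlade1993, Theorem 8.2.1 (8.2.13) (p. 269; proof by bridge renewal, p. 270 — ℤ^d tubes; not the proof formalised)] -/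
theorem stripInsertionCost_le (n : ℕ) (p : Site 2 × (ℕ → Site 2)) (hp : p ∈ stripPairs T n) (c : ℤ)
    (hc : c ∈ admissibleCuts T p.1 p.2 n) : stripInsertionCost T n p c ≤ 4 * T + 8 :=
  (stripInsertionCost_le_sharp hp (mem_admissibleCuts.1 hc).1).trans (by omega)

/-- **(hmem) The image is a self-avoiding walk of the wider strip `S_{T+1}` from the same start, of length
`n + Σ_{c ∈ R} cost(c)`.** [cite: MadrasSlade1993, Theorem 8.2.1 (8.2.13) (p. 269; proof by bridge renewal, p. 270 — ℤ^d tubes; not the proof formalised)] -/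
theorem stripInsertion_mem (n : ℕ) (p : Site 2 × (ℕ → Site 2)) (R : Finset ℤ) (hp : p ∈ stripPairs T n)
    (hR : R ⊆ admissibleCuts T p.1 p.2 n) :
    stripInsertion T n p R ∈ stripPairs (T + 1) (n + ∑ c ∈ R, stripInsertionCost T n p c) := by
  obtain ⟨hW, h0⟩ := stripWalk_of_mem hp
  have hRad : ∀ c ∈ R, (c + (T : ℤ)) % 2 = 1 := fun c hc => (mem_admissibleCuts.1 (hR hc)).2
  obtain ⟨hs, hbw, hin⟩ := psi_spec (R := R) hW hRad
  have hlen : (imageList T ((p.1 + p.2 0) 0) R (fun t => p.1 + p.2 t) n).length - 1 =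
      n + ∑ c ∈ R, stripInsertionCost T n p c := by
    rw [length_imageList hW]; unfold stripInsertionCost; omega
  rw [hlen] at hs hbw hin
  simp only [h0] at hbw hin
  exact mem_stripPairs.2 ⟨stripStarts_mono (Nat.le_succ T) (mem_stripPairs.1 hp).1, hs, hbw, hin⟩

/-- **(hinj) The insertion is injective on the pairs (walk, subset of its admissible cuts).**
[cite: MadrasSlade1993, Theorem 8.2.1 (8.2.13) (p. 269; proof by bridge renewal, p. 270 — ℤ^d tubes; not the proof formalised)] -/
theorem stripInsertion_injOn (T n : ℕ) :
    Set.InjOn (fun q : (Σ _ : Site 2 × (ℕ → Site 2), Finset ℤ) => stripInsertion T n q.1 q.2)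
      {q | q.1 ∈ stripPairs T n ∧ q.2 ⊆ admissibleCuts T q.1.1 q.1.2 n} := by
  rintro ⟨p, R⟩ ⟨hp, hR⟩ ⟨p', R'⟩ ⟨hp', hR'⟩ h
  dsimp only at hp hR hp' hR' h
  obtain ⟨hW, h0⟩ := stripWalk_of_mem hp
  obtain ⟨hW', h0'⟩ := stripWalk_of_mem hp'
  have h' := h
  simp only [stripInsertion, Prod.mk.injEq] at h'
  obtain ⟨ha, hψ⟩ := h'
  -- equal image walks have equal lengths
  have hm := stripInsertion_mem n p R hp hR
  have hm' := stripInsertion_mem n p' R' hp' hR'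
  rw [h] at hm
  have hlen := eq_of_mem_saws_of_mem_saws (mem_stripPairs.1 hm).2.1 (mem_stripPairs.1 hm').2.1
  have hlen' : (imageList T ((p.1 + p.2 0) 0) R (fun t => p.1 + p.2 t) n).length =
      (imageList T ((p'.1 + p'.2 0) 0) R' (fun t => p'.1 + p'.2 t) n).length := by
    rw [length_imageList hW, length_imageList hW']
    unfold stripInsertionCost at hlen
    omega
  have hcR : R ⊆ cutsP (fun t => p.1 + p.2 t) n := fun c hc => by
    rw [cutsP_eq]; exact (mem_admissibleCuts.1 (hR hc)).1
  have hcR' : R' ⊆ cutsP (fun t => p'.1 + p'.2 t) n := fun c hc => by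
    rw [cutsP_eq]; exact (mem_admissibleCuts.1 (hR' hc)).1
  obtain ⟨hRR, hω⟩ := psi_inj hW hW' (by rw [h0, h0', ha]) hcR hcR' hlen' hψ
  have hυ : p.2 = p'.2 := by
    obtain ⟨-, he, -, -⟩ := Zd.mem_saws.1 (mem_stripPairs.1 hp).2.1
    obtain ⟨-, he', -, -⟩ := Zd.mem_saws.1 (mem_stripPairs.1 hp').2.1
    funext t
    rcases le_or_gt t n with ht | ht
    · have := hω t ht; rw [ha] at this; exact add_left_cancel this
    · rw [he t ht.le, he' t ht.le]
      have := hω n le_rfl; rw [ha] at this; exact add_left_cancel this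
  have hpp : p = p' := Prod.ext ha hυ
  subst hpp; subst hRR; rfl

/-- **Faces H1–H3 of the door «HEX-STRIP-STRICT», packaged**: for every width `T` the insertion `Ψ = stripInsertion T`
with cost `stripInsertionCost T` satisfies the three hypotheses (cost `≤ 4T+8`, membership in `stripPairs (T+1)`
at length `n + Σ cost`, injectivity on pairs (walk, admissible-cut subset)) of the summation step
`HexBW.core_of_insertion` / `HexBW.stripConnectiveConstant_lt_succ_of_insertion`.
[cite: MadrasSlade1993, Theorem 8.2.1 (8.2.13) (p. 269; proof by bridge renewal, p. 270 — ℤ^d tubes; not the proof formalised)]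
[cite: BeatonBousquetMelouDeGierDuminilCopinGuttmann2014, Proposition 7 (y = 1) and its proof (arXiv:1109.0358 PDF pp. 11–12; prime unfolded arches — not the proof formalised)] -/
theorem stripInsertion_hyp (T : ℕ) :
    (∀ n p, p ∈ stripPairs T n → ∀ c ∈ admissibleCuts T p.1 p.2 n, stripInsertionCost T n p c ≤ 4 * T + 8) ∧
    (∀ n p R, p ∈ stripPairs T n → R ⊆ admissibleCuts T p.1 p.2 n →
      stripInsertion T n p R ∈ stripPairs (T + 1) (n + ∑ c ∈ R, stripInsertionCost T n p c)) ∧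
    (∀ n, Set.InjOn (fun q : (Σ _ : Site 2 × (ℕ → Site 2), Finset ℤ) => stripInsertion T n q.1 q.2)
      {q | q.1 ∈ stripPairs T n ∧ q.2 ⊆ admissibleCuts T q.1.1 q.1.2 n}) :=
  ⟨fun n p hp c hc => stripInsertionCost_le n p hp c hc, fun n p R hp hR => stripInsertion_mem n p R hp hR,
    fun n => stripInsertion_injOn T n⟩

end Insertion

end Literature.Probability.RandomPlanarGeometry.SAW.HexBW
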